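import Mathlib.NumberTheory.NumberField.CMField
import Literature.NumberTheory.Automorphic.AutomorphicGaloisConj
import Literature.NumberTheory.Automorphic.AutomorphicTwistNorm
import Literature.NumberTheory.Automorphic.AutomorphicRepsGLSatakeFlathProofs
import Literature.NumberTheory.Automorphic.LanglandsTetrahedralProofs
import Literature.NumberTheory.Automorphic.LocalComponentBJExistsProofs
import Literature.NumberTheory.Automorphic.AutomorphicRepsGLCleanModel
import HarnessLib

/-!
# Essentially (Galois-)conjugate self-dual automorphic representations of `GL_n(𝔸_K)`

Topic `NumberTheory/Automorphic`; namespace `Literature.NumberTheory.Automorphic` (definitions in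
`AutomorphicRepData`). For a number field `K`, an automorphism `σ ∈ Aut(K/F)`, a Hecke character
`χ` of `K` and an automorphic representation `π = W / W'` of `GL_n(𝔸_K)` in the sense of
Borel–Jacquet (`AutomorphicRepData (AutomorphyDatum.gl n K hcpt)`: an irreducible
`(𝔤, K_∞) × GL_n(𝔸_K^∞)`-stable subquotient of the space of automorphic forms), this file defines

* `AutomorphicRepData.IsGalConjEssSelfDual π σ χ` (**definition**): `π` is *essentially
  `σ`-conjugate self-dual with similitude character `χ ∘ det`*, `π^σ ≅ π^∨ ⊗ (χ ∘ det)`, where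
  `π^σ(g) = π(σ g)` (Arthur–Clozel's convention, as in `AutomorphicGaloisConj`) and `π^∨` is the
  contragredient. It is recorded in the equivalent **pairing form**: there is a bilinear pairing
  `B : W/W' × W/W' → ℂ`, non-degenerate in each variable, with
  `B(π(σ g) x, π(g) y) = χ(det g) B(x, y)` for `g ∈ G(𝔸_f) = {1} × GL_n(𝔸_K^∞)` (the action
  `π.finiteRep`), the same law for `k ∈ K_∞` (`π.kRep`, with `k' = σ k` read inside `GL_n(𝔸_K)`),
  and its infinitesimal form `B(X' ψ, φ) + B(ψ, X φ) = dχ(X) B(ψ, φ)` for `X ∈ 𝔤`, `X' = σ_* X`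
  (Lie derivatives `π.lieDerivW`; one-parameter subgroups read inside `GL_n(𝔸_K)`). Such a `B` is
  exactly a non-zero `(𝔤, K_∞) × G(𝔸_f)`-invariant pairing between `π^σ` and `π ⊗ (χ ∘ det)⁻¹`,
  i.e. (for admissible `π`, e.g. every automorphic representation of `GL_n`) an isomorphism
  `π^σ ≅ (π ⊗ (χ∘det)⁻¹)^∨ = π^∨ ⊗ (χ ∘ det)` (Bump (1997), §4.2: contragredients and invariant
  bilinear forms). No new automorphic datum (`π^σ`, `π^∨`) needs to be constructed.
* `AutomorphicRepData.IsEssConjSelfDual π χ` (**definition**, `K` a CM field,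
  Mathlib `NumberField.IsCMField`): the case `σ = c` = `NumberField.IsCMField.complexConj K`, i.e.
  `π^c ≅ π^∨ ⊗ (χ ∘ det)` — "essentially conjugate self dual" in the sense of Fakhruddin–Pilloni
  (2021), §9.1 and Barnet-Lamb–Gee–Geraghty–Taylor (2014), §2.1 (RAECSDC, there with
  `χ = χ₀ ∘ N_{K/K⁺}`), Clozel–Harris–Taylor (2008) (RACSDC, `χ = 1`).

and proves the **Satake-level consequence** used by route `Langlands/DegenerateLimits`
(hypothesis (ii) of `OddPolarizableSatakeA` / `CongruencesToRegular` / `SatakeFieldFinite`):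

* `IsGalConjEssSelfDual.exists_satakeParam_smul_eq` (**proved**): if `χ ∘ det` is trivial on the
  integral level `K^max` and `π` has Satake parameters `α` at `v` and `β` at `σ v`
  (`AutomorphicRepData.HasSatakeParamAt`), then `β = {χ_v(ϖ_v) a⁻¹ : a ∈ α}`, i.e.
  `t_{π, σ v} = χ_v(ϖ_v) · t_{π, v}⁻¹` (`t_{π^σ,v} = t_{π,σ v}`, `t_{π^∨,v} = t_{π,v}⁻¹`,
  `t_{π⊗χ,v} = χ_v(ϖ_v) t_{π,v}`; Arthur–Clozel (1989), Ch. 3, p. 172 and Prop. 4.4);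
  `…satakeParam_smul_eq` (the same with `χ.valueAtUniformizer`, `χ` unramified at `v`);
* `IsEssConjSelfDual.satakeParam_complexConj_eq_of_ideleNorm_cpow`,
  `IsEssConjSelfDual.eventually_satakeParam_complexConj_eq` (**proved**): for `K` CM and
  `χ = ‖·‖_𝔸^m`, `m ∈ ℤ`, and *every* `v`,
  `HasSatakeParamAt v α → HasSatakeParamAt (c v) β → β = α.map (a ↦ a⁻¹ q_v^{-m})`, with the
  conjugate place written as in the route, `HeightOneSpectrum.equivOfRingEquiv
  (ringOfIntegersComplexConj K)` (`= c • v`, `IsCMField.complexConj_smul_eq_equivOfRingEquiv`).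

## The proof of the Satake-level consequence

Everything is reduced to proved results of the tree: the unramified Hecke algebra at `v` acts by
scalars modulo `W'` on the forms of `W` spherical at `v`
(`AutomorphicRepData.exists_heckeOperator_sphericalLevelAt_sub_smul_mem`, Flath), `σ` transports
levels, Hecke elements and Satake data (`AutomorphicGaloisConj`), the relation
`t_i⁻¹ = t_n⁻¹ (w t_{n-i} w⁻¹)` with a permutation `w ∈ GL_n(𝒪_v)` and the equality of degrees
`#(K t_i K/K) = #(K t_{n-i} K/K)` (`exists_perm_conj_heckeDiag`, `ncard_orbit_eq_of_inv_eq` of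
`LanglandsTetrahedralProofs`, Bump (1997), Prop. 4.6.2). The new ingredients, all proved here:

1. `heckeEigenvalue_mul_eq_of_bilin_invariant` — the bilinear counterpart of
   `heckeEigenvalue_eq_mul_conj`: for representations `ρ₁, ρ₂` of a group `G`, a pairing `B` with
   `B(ρ₁(g)x, ρ₂(g)y) = c(g)B(x,y)`, `K ≤ G` with `c(K) = 1`, `K`-fixed `x, y` with `B(x,y) ≠ 0`,
   eigenvalues `[KtK]_{ρ₂} y = a y`, `[KsK]_{ρ₁} x = b x`, `ρ₁(z) x = e x` (`z` central),
   `t⁻¹ = z⁻¹ (w s w⁻¹)`, `#(KtK/K) = #(KsK/K)`: then `a e = c(t) b` (the zonal coefficient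
   `g ↦ B(x, ρ₂(g) y)` is bi-`K`-invariant, `apply_heckeOperator_eq_card_mul_of_invariant`).
2. The restriction of `π.finiteRep` to `GL_n(K_v)` along `ι_v` (`GLn.ofLocalFiniteAdelic`) and
   along `σ • ι_v = ι_{σ v} ∘ σ_v` (`GLn.galOfLocalFiniteAdelic`, `…_eq_comp`), with their local
   Hecke operators on `W / W'` computed from the function-level ones
   (`heckeOperator_comp_ofLocalFiniteAdelic_mkQ`, `heckeOperator_comp_galOfLocalFiniteAdelic_mkQ`,
   `comp_galOfLocalFiniteAdelic_heckeDiag_self_mkQ`; transports `heckeOperator_map_apply_eq`,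
   `GLn.map_galAdicCompletionMap_heckeDiag`, `map_sphericalLevelAt_smul`).
3. Averaging over a level (`exists_fixed_mkQ_apply_ne_zero`, `exists_spherical_pairing_ne_zero`):
   a non-zero `K(𝔫)`-invariant linear form on `W / W'` does not vanish on the class of some
   `K(𝔫)`-invariant form (finite index of open subgroups of the compact `K(𝔫)`,
   `finiteIndex_subgroupOf_principalCongruenceLevel`).
4. Vieta (`multiset_eq_map_inv_mul_of_esymm_mul_eq`): `e_i(α) e_n(β) = z^i e_{n-i}(β)` for
   `i ≤ n` forces `β = {z a⁻¹}`.

## Design notes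

* The pairing form avoids constructing `π^σ` and `π^∨` as Borel–Jacquet data (which would need the
  archimedean calculus of `φ ↦ φ ∘ σ` and of `g ↦ ᵗg⁻¹` on `GL_n(K ⊗ ℝ)`); the three clauses are
  the invariance of `B` under `G(𝔸_f)`, `K_∞` and `𝔤`. The elements `σ • g`, `σ • 𝒟.ofK k` and the
  one-parameter subgroups `σ • 𝒟.ofArch (exp tX)` are formed in `GL_n(𝔸_K)` through the action of
  `AutomorphicGaloisConj` (`instMulDistribMulActionGlAdelic`), and the `K_∞`/`𝔤` clauses are stated
  *relationally* (`ofK k' = σ • ofK k`, `∀ t, ofArch (exp tX') = σ • ofArch (exp tX)`), so that no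
  action of `σ` on the abstract archimedean group `𝒟.arch` has to be defined; the differential
  `dχ(X)` enters as `HasDerivAt (t ↦ χ(det (exp tX, 1))) d 0`.
* Both non-degeneracies are recorded; the Satake consequence uses only the left one and only the
  `G(𝔸_f)`-clause.
* `IsEssConjSelfDual` takes an arbitrary Hecke character `χ` of `K`; in the sources
  `χ = χ₀ ∘ N_{K/K⁺}` for a Hecke character `χ₀` of `K⁺` (which can be imposed by the user). The
  central character of `π` is not assumed unitary (Fakhruddin–Pilloni, §9.1), matching the
  Borel–Jacquet model without `A_G`-invariance; for `χ = ‖·‖^m` the integer `m` is the "weight".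
* Typing (Probe5 rule of `AutomorphicRepsGL`): statements about forms use
  `rightTranslation (AdelicGroupData.gl n K)` with `GL_n`-typed level subgroups, as in
  `AutomorphicRepsGLSatakeFlathProofs`; equalities imported from `GL`-typed lemmas
  (`heckeOperator_sphericalLevelAt_eq_principalCongruenceLevel`, …) are re-typed through `have`.
* New definitions: `IsGalConjEssSelfDual`, `IsEssConjSelfDual`, and the two auxiliary embeddings
  `GLn.ofLocalFiniteAdelic`, `GLn.galOfLocalFiniteAdelic`. No instance, no named fact, no `sorry`.

## References

* N. Fakhruddin, V. Pilloni, *Hecke operators and the coherent cohomology of Shimura varieties*,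
  J. Inst. Math. Jussieu 22 (2023), §9.1 ("essentially (conjugate) self dual:
  `π^c = π^∨ ⊗ χ`, `χ = χ₀ ∘ N_{L/F} ∘ det`") [FakhruddinPilloni2021].
* T. Barnet-Lamb, T. Gee, D. Geraghty, R. Taylor, *Potential automorphy and change of weight*,
  Ann. of Math. 179 (2014), §2.1 (RAECSDC: `π^c ≅ π^∨ ⊗ (χ ∘ N_{F/F⁺} ∘ det)`) [BarnetlambEtAl2014].
* L. Clozel, M. Harris, R. Taylor, *Automorphy for some l-adic lifts of automorphic mod l Galois
  representations*, Publ. IHÉS 108 (2008), §1 and §4 (RACSDC) [ClozelHarrisTaylor2008].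
* J. Arthur, L. Clozel, *Simple algebras, base change, and the advanced theory of the trace
  formula*, Ann. of Math. Stud. 120 (1989), Ch. 3, proof of Thm. 3.1 (p. 172) and Prop. 4.4
  [ArthurClozelAMS120].
* D. Bump, *Automorphic forms and representations* (1997), §3.3, §4.2, Prop. 4.6.2 [Bump1997].
* A. Borel, H. Jacquet, *Automorphic forms and automorphic representations*, Corvallis (1979),
  §4.6 [BorelJacquet1979].
-/

noncomputable section

open scoped MatrixGroups
open NumberField IsDedekindDomain

namespace Literature.NumberTheory.Automorphic

open Literature.NumberTheory.GaloisRepresentations (HeckeCharacter)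


/-! ### Hecke operators and twisted-invariant bilinear pairings (abstract) -/

section BilinearHecke

variable {G : Type*} [Group G]

/-- **Zonal coefficients.** For a linear form `Λ` on a representation `ρ` of `G` which is
invariant under `K ≤ G` (`Λ (ρ k v) = Λ v`) and a `K`-fixed vector `v`, the coefficient
`g ↦ Λ (ρ g v)` is bi-`K`-invariant, so that `Λ ([KgK] v) = #(KgK/K) · Λ (ρ g v)` whenever the
double coset `KgK` is a finite union of left cosets (Cartier, Corvallis 1979, §IV.3; Macdonald,
*Spherical functions on a group of p-adic type* (1971), §3.3). [folklore] -/
theorem apply_heckeOperator_eq_card_mul_of_invariant {V : Type*} [AddCommGroup V] [Module ℂ V]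
    (ρ : Representation ℂ G V) (K : Subgroup G) (Λ : V →ₗ[ℂ] ℂ)
    (hΛ : ∀ k ∈ K, ∀ v : V, Λ (ρ k v) = Λ v) (g : G)
    (hfin : (MulAction.orbit K (g : G ⧸ K)).Finite) {v : V} (hv : v ∈ ρ.fixedPoints K) :
    Λ (heckeOperator ρ K g v) = (hfin.toFinset.card : ℂ) * Λ (ρ g v) := by
  classical
  rw [heckeOperator, finsum_mem_eq_finite_toFinset_sum _ hfin, LinearMap.sum_apply, map_sum]
  rw [Finset.sum_congr rfl fun γ hγ => show Λ (ρ γ.out v) = Λ (ρ g v) from ?_, Finset.sum_const,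
    nsmul_eq_mul]
  rw [Set.Finite.mem_toFinset] at hγ
  have hγ' : ((γ.out : G) : G ⧸ K) ∈ MulAction.orbit K (g : G ⧸ K) := by
    rwa [QuotientGroup.out_eq']
  obtain ⟨a, ha, b, hb, hab⟩ := (heckeAlgebra.coe_mem_orbit_coe_iff K g γ.out).1 hγ'
  rw [hab, map_mul, map_mul, Module.End.mul_apply, Module.End.mul_apply,
    (ρ.mem_fixedPoints K v).1 hv b hb, hΛ a ha]

variable {V₁ V₂ : Type*} [AddCommGroup V₁] [Module ℂ V₁] [AddCommGroup V₂] [Module ℂ V₂]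

/-- **Adjoint relation between Hecke eigenvalues through a twisted-invariant bilinear pairing.**
Let `ρ₁, ρ₂` be representations of `G` on `V₁, V₂`, `c : G → ℂˣ` a character and
`B : V₁ × V₂ → ℂ` a bilinear pairing with `B(ρ₁(g) x, ρ₂(g) y) = c(g) B(x, y)`. Let `K ≤ G` with
`c(K) = 1`, `x ∈ V₁^K`, `y ∈ V₂^K` with `B(x, y) ≠ 0`, and suppose `[KtK]_{ρ₂} y = a y`,
`[KsK]_{ρ₁} x = b x`, `ρ₁(z) x = e x` with `z` central, `t⁻¹ = z⁻¹ (w s w⁻¹)` for some `w ∈ K`,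
and `#(KtK/K) = #(KsK/K)` (both finite). Then `a e = c(t) b`: indeed
`B(x, [KtK] y) = #(KtK/K) B(x, ρ₂(t) y) = #(KtK/K) c(t) B(ρ₁(t⁻¹) x, y)` and
`B([KsK] x, y) = #(KsK/K) B(ρ₁(s) x, y)` by bi-`K`-invariance of the coefficients
(`apply_heckeOperator_eq_card_mul_of_invariant`), while `ρ₁(t⁻¹) x = e⁻¹ ρ₁(w) ρ₁(s) x`
(the bilinear counterpart of `heckeEigenvalue_eq_mul_conj`; Deitmar–Echterhoff (2014), proof of
Thm. 11.2.4 (b): `[KtK]* ∝ [Kt⁻¹K]`; Bump (1997), Prop. 4.6.2). [folklore] -/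
theorem heckeEigenvalue_mul_eq_of_bilin_invariant (ρ₁ : Representation ℂ G V₁)
    (ρ₂ : Representation ℂ G V₂) (c : G →* ℂˣ) (B : V₁ →ₗ[ℂ] V₂ →ₗ[ℂ] ℂ)
    (hB : ∀ (g : G) (x : V₁) (y : V₂), B (ρ₁ g x) (ρ₂ g y) = ((c g : ℂˣ) : ℂ) * B x y)
    (K : Subgroup G) (hcK : ∀ k ∈ K, c k = 1)
    {x : V₁} (hx : x ∈ ρ₁.fixedPoints K) {y : V₂} (hy : y ∈ ρ₂.fixedPoints K)
    {t s z w : G} (hw : w ∈ K) (hz : z ∈ Subgroup.center G) (htsz : t⁻¹ = z⁻¹ * (w * s * w⁻¹))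
    (ht : (MulAction.orbit K (t : G ⧸ K)).Finite) (hs : (MulAction.orbit K (s : G ⧸ K)).Finite)
    (hN : ht.toFinset.card = hs.toFinset.card) {a b e : ℂ}
    (ha : heckeOperator ρ₂ K t y = a • y) (hb : heckeOperator ρ₁ K s x = b • x)
    (he : ρ₁ z x = e • x) (hBxy : B x y ≠ 0) :
    a * e = ((c t : ℂˣ) : ℂ) * b := by
  have hfix₁ : ∀ k ∈ K, ρ₁ k x = x := fun k hk => (Representation.mem_fixedPoints _ _ _).1 hx k hk
  have hfix₂ : ∀ k ∈ K, ρ₂ k y = y := fun k hk => (Representation.mem_fixedPoints _ _ _).1 hy k hk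
  have hcancel₁ : ∀ (g : G) (u : V₁), ρ₁ g (ρ₁ g⁻¹ u) = u := fun g u => by
    rw [← Module.End.mul_apply, ← map_mul, mul_inv_cancel, map_one, Module.End.one_apply]
  -- `x ≠ 0`, hence `e ≠ 0` and `ρ₁ z⁻¹ x = e⁻¹ x`
  have hx0 : x ≠ 0 := by
    rintro rfl
    exact hBxy (by rw [map_zero, LinearMap.zero_apply])
  have hzz : ρ₁ z⁻¹ (ρ₁ z x) = x := by
    rw [← Module.End.mul_apply, ← map_mul, inv_mul_cancel, map_one, Module.End.one_apply]
  have he0 : e ≠ 0 := by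
    rintro rfl
    rw [zero_smul] at he
    rw [he, map_zero] at hzz
    exact hx0 hzz.symm
  have hzinv : ρ₁ z⁻¹ x = e⁻¹ • x := by
    rw [he, map_smul] at hzz
    calc ρ₁ z⁻¹ x = e⁻¹ • (e • ρ₁ z⁻¹ x) := by rw [smul_smul, inv_mul_cancel₀ he0, one_smul]
      _ = e⁻¹ • x := by rw [hzz]
  -- `ρ₁ z⁻¹` commutes with every `ρ₁ g`
  have hzc : ∀ (g : G) (u : V₁), ρ₁ z⁻¹ (ρ₁ g u) = ρ₁ g (ρ₁ z⁻¹ u) := fun g u => by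
    calc ρ₁ z⁻¹ (ρ₁ g u) = ρ₁ (z⁻¹ * g) u := by rw [map_mul, Module.End.mul_apply]
      _ = ρ₁ (g * z⁻¹) u := by rw [(Subgroup.mem_center_iff.1 (inv_mem hz)) g]
      _ = ρ₁ g (ρ₁ z⁻¹ u) := by rw [map_mul, Module.End.mul_apply]
  -- invariance of the two partial linear forms under `K`
  have hΛ₂ : ∀ k ∈ K, ∀ v : V₂, B x (ρ₂ k v) = B x v := by
    intro k hk v
    have h := hB k (ρ₁ k⁻¹ x) v
    rw [hcancel₁, hfix₁ k⁻¹ (inv_mem hk), hcK k hk, Units.val_one, one_mul] at h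
    exact h
  have hΛ₁ : ∀ k ∈ K, ∀ u : V₁, B (ρ₁ k u) y = B u y := by
    intro k hk u
    have h := hB k u y
    rw [hfix₂ k hk, hcK k hk, Units.val_one, one_mul] at h
    exact h
  have hΛ₁' : ∀ k ∈ K, ∀ u : V₁, B.flip y (ρ₁ k u) = B.flip y u := fun k hk u => by
    simp only [LinearMap.flip_apply]
    exact hΛ₁ k hk u
  -- (1) `a B(x,y) = #(KtK/K) B(x, ρ₂ t y)`
  have h1 : a * B x y = (ht.toFinset.card : ℂ) * B x (ρ₂ t y) := by
    have h := apply_heckeOperator_eq_card_mul_of_invariant ρ₂ K (B x) hΛ₂ t ht hy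
    rw [ha, map_smul, smul_eq_mul] at h
    exact h
  -- (2) `B(x, ρ₂ t y) = c(t) B(ρ₁ t⁻¹ x, y)`
  have h2 : B x (ρ₂ t y) = ((c t : ℂˣ) : ℂ) * B (ρ₁ t⁻¹ x) y := by
    have h := hB t (ρ₁ t⁻¹ x) y
    rw [hcancel₁] at h
    exact h
  -- (3) `B(ρ₁ t⁻¹ x, y) = e⁻¹ B(ρ₁ s x, y)`
  have h3 : B (ρ₁ t⁻¹ x) y = e⁻¹ * B (ρ₁ s x) y := by
    calc B (ρ₁ t⁻¹ x) y = B (ρ₁ z⁻¹ (ρ₁ w (ρ₁ s (ρ₁ w⁻¹ x)))) y := by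
          simp only [htsz, map_mul, Module.End.mul_apply]
      _ = B (ρ₁ w (ρ₁ s (ρ₁ z⁻¹ x))) y := by rw [hfix₁ w⁻¹ (inv_mem hw), hzc w, hzc s]
      _ = e⁻¹ * B (ρ₁ w (ρ₁ s x)) y := by
          rw [hzinv, map_smul, map_smul, map_smul, LinearMap.smul_apply, smul_eq_mul]
      _ = e⁻¹ * B (ρ₁ s x) y := by rw [hΛ₁ w hw]
  -- (4) `b B(x,y) = #(KsK/K) B(ρ₁ s x, y)`
  have h4 : b * B x y = (hs.toFinset.card : ℂ) * B (ρ₁ s x) y := by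
    have h := apply_heckeOperator_eq_card_mul_of_invariant ρ₁ K (B.flip y) hΛ₁' s hs hx
    simp only [LinearMap.flip_apply] at h
    rw [hb, map_smul, LinearMap.smul_apply, smul_eq_mul] at h
    exact h
  rw [hN] at h1
  have key : a * e * B x y = ((c t : ℂˣ) : ℂ) * b * B x y := by
    calc a * e * B x y = e * (a * B x y) := by ring
      _ = e * ((hs.toFinset.card : ℂ) * (((c t : ℂˣ) : ℂ) * (e⁻¹ * B (ρ₁ s x) y))) := by
          rw [h1, h2, h3]
      _ = (e * e⁻¹) * (((c t : ℂˣ) : ℂ) * ((hs.toFinset.card : ℂ) * B (ρ₁ s x) y)) := by ring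
      _ = ((c t : ℂˣ) : ℂ) * ((hs.toFinset.card : ℂ) * B (ρ₁ s x) y) := by
          rw [mul_inv_cancel₀ he0, one_mul]
      _ = ((c t : ℂˣ) : ℂ) * (b * B x y) := by rw [← h4]
      _ = ((c t : ℂˣ) : ℂ) * b * B x y := by ring
  exact mul_right_cancel₀ hBxy key

end BilinearHecke

/-! ### Transport lemmas: orbits along injective homomorphisms, `σ` on `GL_n(𝔸_K)` -/

section OrbitTransport

variable {G₀ G : Type*} [Group G₀] [Group G]

/-- Along an injective homomorphism `f : G₀ → G`, the double coset `f(K₀) f(g₀) f(K₀) / f(K₀)`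
is finite with the same number of left cosets as `K₀ g₀ K₀ / K₀` (one transversal serves both,
`bijOn_image_map`; Bump (1997), §3.3). [folklore] -/
theorem finite_orbit_map_and_ncard_eq (f : G₀ →* G) (hf : Function.Injective f)
    (K₀ : Subgroup G₀) (g₀ : G₀) (hfin : (MulAction.orbit K₀ (g₀ : G₀ ⧸ K₀)).Finite) :
    (MulAction.orbit (K₀.map f) (f g₀ : G ⧸ K₀.map f)).Finite ∧
      (MulAction.orbit (K₀.map f) (f g₀ : G ⧸ K₀.map f)).ncard =
        (MulAction.orbit K₀ (g₀ : G₀ ⧸ K₀)).ncard := by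
  classical
  let s₀ : Finset G₀ := hfin.toFinset.image Quotient.out
  have hs₀ : Set.BijOn (fun x : G₀ => (x : G₀ ⧸ K₀)) s₀ (MulAction.orbit K₀ (g₀ : G₀ ⧸ K₀)) := by
    refine ⟨?_, ?_, ?_⟩
    · intro x hx
      obtain ⟨y, hy, rfl⟩ := Finset.mem_image.1 hx
      rw [Set.Finite.mem_toFinset] at hy
      simpa only [QuotientGroup.out_eq'] using hy
    · intro x hx x' hx' h
      obtain ⟨y, -, rfl⟩ := Finset.mem_image.1 hx
      obtain ⟨y', -, rfl⟩ := Finset.mem_image.1 hx'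
      simp only [QuotientGroup.out_eq'] at h
      rw [h]
    · intro y hy
      refine ⟨y.out, Finset.mem_image.2 ⟨y, (Set.Finite.mem_toFinset _).2 hy, rfl⟩, ?_⟩
      exact QuotientGroup.out_eq' y
  have h := bijOn_image_map f hf K₀ g₀ s₀ hs₀
  refine ⟨?_, ?_⟩
  · rw [← h.image_eq]
    exact (Finset.finite_toSet _).image _
  · rw [← h.image_eq, ← hs₀.image_eq, h.injOn.ncard_image, hs₀.injOn.ncard_image,
      Set.ncard_coe_finset, Set.ncard_coe_finset, Finset.card_image_of_injective _ hf]

end OrbitTransport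

section GalTransport

variable (F : Type*) [Field F] {K : Type} [Field K] [NumberField K] [Algebra F K] {n : ℕ}

/-- `σ ∈ Aut(K/F)` preserves the finite-adelic subgroup `{1} × GL_n(𝔸_K^∞) = range GLn.ofFinite`
of `GL_n(𝔸_K)` (its archimedean component stays `1`). [folklore] -/
theorem GLn.smul_mem_range_ofFinite (σ : K ≃ₐ[F] K) {g : GL (Fin n) (AdeleRing (𝓞 K) K)}
    (hg : g ∈ (GLn.ofFinite n K).range) : σ • g ∈ (GLn.ofFinite n K).range := by
  obtain ⟨h, rfl⟩ := hg
  refine ⟨GLn.sndHom n K (σ • GLn.ofFinite n K h), GLn.ext_of_fstHom_of_sndHom ?_ ?_⟩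
  · rw [GLn.fstHom_ofFinite]
    symm
    refine Matrix.GeneralLinearGroup.ext fun i j => ?_
    change (((σ • GLn.ofFinite n K h : GL (Fin n) (AdeleRing (𝓞 K) K)) :
        Matrix (Fin n) (Fin n) (AdeleRing (𝓞 K) K)) i j).1 =
      ((1 : GL (Fin n) (InfiniteAdeleRing K)) : Matrix (Fin n) (Fin n) (InfiniteAdeleRing K)) i j
    rw [GeneralLinearGroup.coe_smul_apply, AdeleRing.smul_fst, GLn.coe_ofFinite_apply, Units.val_one]
    dsimp only
    by_cases hij : i = j
    · subst hij
      rw [Matrix.one_apply_eq]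
      exact smul_one σ
    · rw [Matrix.one_apply_ne hij]
      exact smul_zero σ
  · rw [GLn.sndHom_ofFinite]

/-- `σ_w` maps `GL_n(𝒪_w)` onto `GL_n(𝒪_{σ w})`. [folklore] -/
theorem GLn.map_valuedCongruenceSubgroup_one_galAdicCompletionMap (σ : K ≃ₐ[F] K)
    {w w' : HeightOneSpectrum (𝓞 K)} (h : σ • w = w') :
    (valuedCongruenceSubgroup (Fin n) (1 : WithZero (Multiplicative ℤ)) :
        Subgroup (GL (Fin n) (w.adicCompletion K))).map
        (Matrix.GeneralLinearGroup.map (galAdicCompletionMap (L := K) σ h :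
          w.adicCompletion K →+* w'.adicCompletion K)) =
      (valuedCongruenceSubgroup (Fin n) (1 : WithZero (Multiplicative ℤ)) :
        Subgroup (GL (Fin n) (w'.adicCompletion K))) := by
  ext x
  constructor
  · rintro ⟨y, hy, rfl⟩
    exact (GLn.map_galAdicCompletionMap_mem_valuedCongruenceSubgroup_iff F σ h 1 y).2 hy
  · intro hx
    refine ⟨Matrix.GeneralLinearGroup.map (galAdicCompletionMap σ⁻¹ (inv_smul_eq_of_smul_eq h)) x,
      (GLn.map_galAdicCompletionMap_mem_valuedCongruenceSubgroup_iff F σ⁻¹ _ 1 x).2 hx, ?_⟩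
    refine Matrix.GeneralLinearGroup.ext fun i j => ?_
    simp only [Matrix.GeneralLinearGroup.map_apply]
    exact galAdicCompletionMap_apply_inv K σ h (inv_smul_eq_of_smul_eq h) _

/-- **`σ` on the local spherical levels**: `σ (GL_n(𝒪_v)) = GL_n(𝒪_{σ v})` inside `GL_n(𝔸_K)`,
i.e. the image of `sphericalLevelAt K n v` under `σ` is `sphericalLevelAt K n (σ • v)`
(`GLn.smul_ofLocal`). [folklore] -/
theorem map_sphericalLevelAt_smul (σ : K ≃ₐ[F] K) (v : HeightOneSpectrum (𝓞 K)) :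
    (Literature.NumberTheory.Automorphic.sphericalLevelAt K n v).map
        (MulDistribMulAction.toMonoidHom (GL (Fin n) (AdeleRing (𝓞 K) K)) σ) =
      Literature.NumberTheory.Automorphic.sphericalLevelAt K n (σ • v) := by
  have hcomp : (MulDistribMulAction.toMonoidHom (GL (Fin n) (AdeleRing (𝓞 K) K)) σ).comp
      (GLn.ofLocal n K v) = (GLn.ofLocal n K (σ • v)).comp
        (Matrix.GeneralLinearGroup.map (galAdicCompletionMap σ rfl)) :=
    MonoidHom.ext fun x => GLn.smul_ofLocal F σ v x
  change ((valuedCongruenceSubgroup (Fin n) (1 : WithZero (Multiplicative ℤ))).map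
      (GLn.ofLocal n K v)).map _ = (valuedCongruenceSubgroup (Fin n) _).map (GLn.ofLocal n K (σ • v))
  rw [Subgroup.map_map, hcomp, ← Subgroup.map_map,
    GLn.map_valuedCongruenceSubgroup_one_galAdicCompletionMap F σ rfl]

/-- `σ • k ∈ GL_n(𝒪_{σ v})` for `k ∈ GL_n(𝒪_v)` (placed at `v`, resp. `σ v`). [folklore] -/
theorem smul_mem_sphericalLevelAt (σ : K ≃ₐ[F] K) (v : HeightOneSpectrum (𝓞 K))
    {k : GL (Fin n) (AdeleRing (𝓞 K) K)} (hk : k ∈ Literature.NumberTheory.Automorphic.sphericalLevelAt K n v) :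
    σ • k ∈ Literature.NumberTheory.Automorphic.sphericalLevelAt K n (σ • v) := by
  rw [← map_sphericalLevelAt_smul F σ v]
  exact ⟨k, hk, rfl⟩

/-- The conjugate places have the same residue cardinality: `q_{σ v} = q_v`. [folklore] -/
theorem HeightOneSpectrum.residueCard_smul (σ : K ≃ₐ[F] K) (v : HeightOneSpectrum (𝓞 K)) :
    (σ • v).residueCard = v.residueCard :=
  HeightOneSpectrum.absNorm_algEquiv_smul F σ v

end GalTransport

section CMPlaces

variable {K : Type} [Field K] [NumberField K] [IsCMField K]

/-- **Complex conjugation on the finite places of a CM field.** The place `c • v` (conjugate prime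
`c(𝔭_v)`, the action of `GaloisActionPlaces`) is Mathlib's transport of `v` along the ring
automorphism `ringOfIntegersComplexConj K` of `𝓞 K` (`HeightOneSpectrum.equivOfRingEquiv`, whose
prime is `c⁻¹(𝔭_v) = c(𝔭_v)` since `c² = 1`). [folklore] -/
theorem IsCMField.complexConj_smul_eq_equivOfRingEquiv (v : HeightOneSpectrum (𝓞 K)) :
    NumberField.IsCMField.complexConj K • v =
      HeightOneSpectrum.equivOfRingEquiv
        (NumberField.IsCMField.ringOfIntegersComplexConj K).toRingEquiv v := by
  apply HeightOneSpectrum.ext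
  rw [HeightOneSpectrum.smul_asIdeal, Ideal.pointwise_smul_def]
  change _ = Ideal.comap _ v.asIdeal
  rw [show Ideal.comap ((NumberField.IsCMField.ringOfIntegersComplexConj K).toRingEquiv.symm :
      𝓞 K →+* 𝓞 K) v.asIdeal = Ideal.map
        ((NumberField.IsCMField.ringOfIntegersComplexConj K).toRingEquiv : 𝓞 K →+* 𝓞 K) v.asIdeal
      from (Ideal.map_comap_of_equiv _).symm]
  congr 1

end CMPlaces

/-! ### Local embeddings into the finite-adelic group and their Hecke operators on `W / W'` -/

section LocalFiniteAdelic

open scoped Classical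

variable (F : Type*) [Field F] {n : ℕ} {K : Type} [Field K] [NumberField K] [Algebra F K]
  (hcpt : isCompact_glFiniteIntegralLevel n K)

/-- The local embedding `ι_v : GL_n(K_v) →* G(𝔸_f) = {1} × GL_n(𝔸_K^∞)` of the `GL_n` automorphy
datum (range restriction of `GLn.ofLocal`, `GLn.ofLocal_mem_range_ofFinite`), through which the
`G(𝔸_f)`-action `π.finiteRep` on `W / W'` is restricted to `GL_n(K_v)`.
Godement–Jacquet, LNM 260, §10. [folklore] -/
def GLn.ofLocalFiniteAdelic (v : HeightOneSpectrum (𝓞 K)) :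
    GL (Fin n) (v.adicCompletion K) →* (AutomorphyDatum.gl n K hcpt).finiteAdelic :=
  (GLn.ofLocal n K v).codRestrict _ fun g => GLn.ofLocal_mem_range_ofFinite v g

/-- The `σ`-twisted local embedding `g ↦ σ • ι_v(g) = ι_{σ v}(σ_v g)` into `G(𝔸_f)`, through which
`π^σ = π ∘ σ` is restricted to `GL_n(K_v)`. [folklore] -/
def GLn.galOfLocalFiniteAdelic (σ : K ≃ₐ[F] K) (v : HeightOneSpectrum (𝓞 K)) :
    GL (Fin n) (v.adicCompletion K) →* (AutomorphyDatum.gl n K hcpt).finiteAdelic :=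
  ((MulDistribMulAction.toMonoidHom (GL (Fin n) (AdeleRing (𝓞 K) K)) σ).comp
    (GLn.ofLocal n K v)).codRestrict _ fun g =>
      GLn.smul_mem_range_ofFinite F σ (GLn.ofLocal_mem_range_ofFinite v g)

variable {hcpt}

/-- `ι_v(g)` as an element of `GL_n(𝔸_K)` (definitional). [folklore] -/
@[simp] theorem GLn.coe_ofLocalFiniteAdelic (v : HeightOneSpectrum (𝓞 K))
    (g : GL (Fin n) (v.adicCompletion K)) :
    ((GLn.ofLocalFiniteAdelic hcpt v g : (AutomorphyDatum.gl n K hcpt).finiteAdelic) :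
      (AdelicGroupData.gl n K).Adelic) = GLn.ofLocal n K v g := rfl

/-- `σ • ι_v(g)` as an element of `GL_n(𝔸_K)` (definitional). [folklore] -/
@[simp] theorem GLn.coe_galOfLocalFiniteAdelic (σ : K ≃ₐ[F] K) (v : HeightOneSpectrum (𝓞 K))
    (g : GL (Fin n) (v.adicCompletion K)) :
    ((GLn.galOfLocalFiniteAdelic F hcpt σ v g : (AutomorphyDatum.gl n K hcpt).finiteAdelic) :
      (AdelicGroupData.gl n K).Adelic) = σ • GLn.ofLocal n K v g := rfl

/-- `GL_n` of an injective ring homomorphism is injective. [folklore] -/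
theorem GeneralLinearGroup.map_injective {R S : Type*} [CommRing R] [CommRing S] {m : Type*}
    [Fintype m] [DecidableEq m] {f : R →+* S} (hf : Function.Injective f) :
    Function.Injective (Matrix.GeneralLinearGroup.map (n := m) f) := fun x y h =>
  Matrix.GeneralLinearGroup.ext fun i j => hf (by
    have := congrArg (fun g : GL m S => (g : Matrix m m S) i j) h
    simpa only [Matrix.GeneralLinearGroup.map_apply] using this)

/-- **`σ_v` on the local Hecke elements**: `σ_v (t_j(ϖ)) = t_j(σ_v ϖ)` in `GL_n(K_{σ v})`
(read off `GLn.smul_heckeDiagAt` through the injective `ι_{σ v}`). [folklore] -/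
theorem GLn.map_galAdicCompletionMap_heckeDiag (σ : K ≃ₐ[F] K) (v : HeightOneSpectrum (𝓞 K))
    (ϖ : (v.adicCompletion K)ˣ) (j : ℕ) :
    Matrix.GeneralLinearGroup.map (galAdicCompletionMap (L := K) σ (rfl : σ • v = σ • v))
        (heckeDiag n ϖ j) =
      heckeDiag n (galAdicCompletionUnitsEquiv (L := K) σ (rfl : σ • v = σ • v) ϖ) j := by
  apply GLn.ofLocal_injective (n := n) (K := K) (v := σ • v)
  rw [← GLn.smul_ofLocal F σ v, ← heckeDiagAt_eq_ofLocal, ← heckeDiagAt_eq_ofLocal,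
    GLn.smul_heckeDiagAt F σ v ϖ j]

/-- `σ • ι_v = ι_{σ v} ∘ σ_v` as homomorphisms into `G(𝔸_f)` (`GLn.smul_ofLocal`). [folklore] -/
theorem GLn.galOfLocalFiniteAdelic_eq_comp (σ : K ≃ₐ[F] K) (v : HeightOneSpectrum (𝓞 K)) :
    GLn.galOfLocalFiniteAdelic F hcpt σ v = (GLn.ofLocalFiniteAdelic hcpt (σ • v)).comp
      (Matrix.GeneralLinearGroup.map (galAdicCompletionMap (L := K) σ (rfl : σ • v = σ • v))) :=
  MonoidHom.ext fun g => Subtype.ext (GLn.smul_ofLocal F σ v g)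

/-- The local spherical level `GL_n(𝒪_v)` placed at `v` lies in `G(𝔸_f)`. [folklore] -/
theorem sphericalLevelAt_le_finiteAdelic (v : HeightOneSpectrum (𝓞 K)) :
    Literature.NumberTheory.Automorphic.sphericalLevelAt K n v ≤ (AutomorphyDatum.gl n K hcpt).finiteAdelic := by
  rintro _ ⟨g, -, rfl⟩
  exact GLn.ofLocal_mem_range_ofFinite v g

namespace AutomorphicRepData

variable (π : AutomorphicRepData (AutomorphyDatum.gl n K hcpt))

/-- Equivariant linear maps intertwine Hecke operators (both sides are the same sum over the
representatives `Quotient.out`; Bump (1997), proof of Thm. 3.6.1). [folklore] -/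
theorem map_heckeOperator_apply_of_comm {G V V' : Type*} [Group G] [AddCommGroup V] [Module ℂ V]
    [AddCommGroup V'] [Module ℂ V'] (ρ : Representation ℂ G V) (ρ' : Representation ℂ G V')
    (Kf : Subgroup G) (L : V →ₗ[ℂ] V') (hL : ∀ (g : G) (v : V), L (ρ g v) = ρ' g (L v)) (g : G)
    (hfin : (MulAction.orbit Kf (g : G ⧸ Kf)).Finite) (v : V) :
    L (heckeOperator ρ Kf g v) = heckeOperator ρ' Kf g (L v) := by
  classical
  rw [heckeOperator, heckeOperator, finsum_mem_eq_finite_toFinset_sum _ hfin,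
    finsum_mem_eq_finite_toFinset_sum _ hfin, LinearMap.sum_apply, LinearMap.sum_apply, map_sum]
  exact Finset.sum_congr rfl fun y _ => hL _ _

/-- **Local Hecke operators on `W / W'`.** If `φ ∈ W` is spherical at `w` and
`[GL_n(𝒪_w) ι_w(t) GL_n(𝒪_w)] φ ≡ c φ (mod W')` (function level, `sphericalLevelAt`), then on the
class `[φ] ∈ W / W'` the Hecke operator of `(GL_n(K_w), GL_n(𝒪_w))` at `t` for the restricted
action `π.finiteRep ∘ ι_w` is multiplication by `c` (transport along `W → W / W'`, along
`W ↪ (functions)` and along the injective `ι_w`, `heckeOperator_map_apply_eq`; Bump (1997), §3.3;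
Borel–Jacquet (1979), §4.6). [folklore] -/
theorem heckeOperator_comp_ofLocalFiniteAdelic_mkQ (w : HeightOneSpectrum (𝓞 K))
    (t : GL (Fin n) (w.adicCompletion K)) (φ : π.W)
    (hφ : (φ : (AdelicGroupData.gl n K).Adelic → ℂ) ∈
      (rightTranslation (AdelicGroupData.gl n K)).fixedPoints (Literature.NumberTheory.Automorphic.sphericalLevelAt K n w))
    {c : ℂ} (hc : heckeOperator (rightTranslation (AdelicGroupData.gl n K))
      (Literature.NumberTheory.Automorphic.sphericalLevelAt K n w) (GLn.ofLocal n K w t) φ - c • (φ : _ → ℂ) ∈ π.W') :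
    heckeOperator (π.finiteRep.comp (GLn.ofLocalFiniteAdelic hcpt w))
        (valuedCongruenceSubgroup (Fin n) (1 : WithZero (Multiplicative ℤ))) t (π.mkQ φ) =
      c • π.mkQ φ := by
  set K₀ : Subgroup (GL (Fin n) (w.adicCompletion K)) :=
    valuedCongruenceSubgroup (Fin n) (1 : WithZero (Multiplicative ℤ)) with hK₀
  have hfin : (MulAction.orbit K₀ (t : GL (Fin n) (w.adicCompletion K) ⧸ K₀)).Finite :=
    finite_orbit_valuedCongruenceSubgroup_one n K w t
  -- transport along `W → W / W'`
  have h1 : π.mkQ (heckeOperator (π.finiteRepW.comp (GLn.ofLocalFiniteAdelic hcpt w)) K₀ t φ) =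
      heckeOperator (π.finiteRep.comp (GLn.ofLocalFiniteAdelic hcpt w)) K₀ t (π.mkQ φ) :=
    map_heckeOperator_apply_of_comm _ _ K₀ π.mkQ (fun _ _ => rfl) t hfin φ
  -- transport along `W ↪ functions` and along `ι_w`
  have h2 : ((heckeOperator (π.finiteRepW.comp (GLn.ofLocalFiniteAdelic hcpt w)) K₀ t φ : π.W) :
      (AdelicGroupData.gl n K).Adelic → ℂ) =
      heckeOperator (rightTranslation (AdelicGroupData.gl n K))
        (Literature.NumberTheory.Automorphic.sphericalLevelAt K n w) (GLn.ofLocal n K w t) φ := by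
    have e1 := map_heckeOperator_apply_of_comm (π.finiteRepW.comp (GLn.ofLocalFiniteAdelic hcpt w))
      ((rightTranslation (AdelicGroupData.gl n K)).comp (GLn.ofLocal n K w)) K₀ π.W.subtype
      (fun _ _ => rfl) t hfin φ
    rw [Submodule.subtype_apply] at e1
    rw [e1]
    exact (heckeOperator_map_apply_eq (GLn.ofLocal n K w) GLn.ofLocal_injective K₀
      (rightTranslation (AdelicGroupData.gl n K)) t hfin hφ).symm
  rw [← h1]
  rw [← map_smul]
  refine (Submodule.Quotient.eq π.kerQuot).2 ?_
  change ((heckeOperator (π.finiteRepW.comp (GLn.ofLocalFiniteAdelic hcpt w)) K₀ t φ - c • φ : π.W) :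
    (AdelicGroupData.gl n K).Adelic → ℂ) ∈ π.W'
  rw [Submodule.coe_sub, Submodule.coe_smul, h2]
  exact hc

/-- The class of a form spherical at `v` is fixed by `GL_n(𝒪_v)` acting through `ι_v`. [folklore] -/
theorem mkQ_mem_fixedPoints_comp_ofLocalFiniteAdelic (v : HeightOneSpectrum (𝓞 K)) (φ : π.W)
    (hφ : (φ : (AdelicGroupData.gl n K).Adelic → ℂ) ∈
      (rightTranslation (AdelicGroupData.gl n K)).fixedPoints (Literature.NumberTheory.Automorphic.sphericalLevelAt K n v)) :
    π.mkQ φ ∈ Representation.fixedPoints (π.finiteRep.comp (GLn.ofLocalFiniteAdelic hcpt v))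
      (valuedCongruenceSubgroup (Fin n) (1 : WithZero (Multiplicative ℤ))) := by
  refine (Representation.mem_fixedPoints _ _ _).2 fun k hk => ?_
  have e : π.finiteRepW (GLn.ofLocalFiniteAdelic hcpt v k) φ = φ :=
    Subtype.ext ((Representation.mem_fixedPoints _ _ _).1 hφ _ ⟨k, hk, rfl⟩)
  exact congrArg π.mkQ e

/-- The class of a form spherical at `σ v` is fixed by `GL_n(𝒪_v)` acting through the twisted
embedding `σ • ι_v = ι_{σ v} ∘ σ_v` (`σ_v GL_n(𝒪_v) = GL_n(𝒪_{σ v})`). [folklore] -/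
theorem mkQ_mem_fixedPoints_comp_galOfLocalFiniteAdelic (σ : K ≃ₐ[F] K) (v : HeightOneSpectrum (𝓞 K))
    (ψ : π.W) (hψ : (ψ : (AdelicGroupData.gl n K).Adelic → ℂ) ∈
      (rightTranslation (AdelicGroupData.gl n K)).fixedPoints
        (Literature.NumberTheory.Automorphic.sphericalLevelAt K n (σ • v))) :
    π.mkQ ψ ∈ Representation.fixedPoints (π.finiteRep.comp (GLn.galOfLocalFiniteAdelic F hcpt σ v))
      (valuedCongruenceSubgroup (Fin n) (1 : WithZero (Multiplicative ℤ))) := by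
  refine (Representation.mem_fixedPoints _ _ _).2 fun k hk => ?_
  have hk' : σ • GLn.ofLocal n K v k ∈ Literature.NumberTheory.Automorphic.sphericalLevelAt K n (σ • v) :=
    smul_mem_sphericalLevelAt F σ v ⟨k, hk, rfl⟩
  have e : π.finiteRepW (GLn.galOfLocalFiniteAdelic F hcpt σ v k) ψ = ψ :=
    Subtype.ext ((Representation.mem_fixedPoints _ _ _).1 hψ _ hk')
  exact congrArg π.mkQ e

/-- **Local Hecke operators of `π^σ` on `W / W'`.** For `ψ ∈ W` spherical at `σ v` with
`[GL_n(𝒪_{σ v}) t_j(σ_v ϖ) GL_n(𝒪_{σ v})] ψ ≡ c ψ (mod W')`, the Hecke operator of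
`(GL_n(K_v), GL_n(𝒪_v))` at `t_j(ϖ)` for the twisted action `π.finiteRep ∘ (σ • ι_v)` (i.e. for
`π^σ` restricted to `GL_n(K_v)`) multiplies `[ψ]` by `c`: transport along the isomorphism
`σ_v : GL_n(K_v) → GL_n(K_{σ v})` (`heckeOperator_map_apply_eq`), which maps `GL_n(𝒪_v)` onto
`GL_n(𝒪_{σ v})` and `t_j(ϖ)` to `t_j(σ_v ϖ)` (`GLn.map_galAdicCompletionMap_heckeDiag`), then
`heckeOperator_comp_ofLocalFiniteAdelic_mkQ` at `σ v` (Arthur–Clozel (1989), Ch. 3, Prop. 4.4: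
`t_{Π^σ, v} = t_{Π, σ v}`). [folklore] -/
theorem heckeOperator_comp_galOfLocalFiniteAdelic_mkQ (σ : K ≃ₐ[F] K) (v : HeightOneSpectrum (𝓞 K))
    (ϖ : (v.adicCompletion K)ˣ) (j : ℕ) (ψ : π.W)
    (hψ : (ψ : (AdelicGroupData.gl n K).Adelic → ℂ) ∈
      (rightTranslation (AdelicGroupData.gl n K)).fixedPoints
        (Literature.NumberTheory.Automorphic.sphericalLevelAt K n (σ • v)))
    {c : ℂ} (hc : heckeOperator (rightTranslation (AdelicGroupData.gl n K))
      (Literature.NumberTheory.Automorphic.sphericalLevelAt K n (σ • v))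
      (GLn.ofLocal n K (σ • v) (heckeDiag n
        (galAdicCompletionUnitsEquiv (L := K) σ (rfl : σ • v = σ • v) ϖ) j)) ψ - c • (ψ : _ → ℂ) ∈ π.W') :
    heckeOperator (π.finiteRep.comp (GLn.galOfLocalFiniteAdelic F hcpt σ v))
        (valuedCongruenceSubgroup (Fin n) (1 : WithZero (Multiplicative ℤ))) (heckeDiag n ϖ j) (π.mkQ ψ) =
      c • π.mkQ ψ := by
  have hgal_inj : Function.Injective (Matrix.GeneralLinearGroup.map (n := Fin n)
      (galAdicCompletionMap (L := K) σ (rfl : σ • v = σ • v))) :=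
    GeneralLinearGroup.map_injective (galAdicCompletionEquiv (L := K) σ rfl).injective
  have hKmap := GLn.map_valuedCongruenceSubgroup_one_galAdicCompletionMap (n := n) F σ (rfl : σ • v = σ • v)
  have hxmap : π.mkQ ψ ∈ Representation.fixedPoints
      (π.finiteRep.comp (GLn.ofLocalFiniteAdelic hcpt (σ • v)))
      ((valuedCongruenceSubgroup (Fin n) (1 : WithZero (Multiplicative ℤ)) :
        Subgroup (GL (Fin n) (v.adicCompletion K))).map
        (Matrix.GeneralLinearGroup.map (galAdicCompletionMap (L := K) σ (rfl : σ • v = σ • v)))) := by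
    rw [hKmap]
    exact π.mkQ_mem_fixedPoints_comp_ofLocalFiniteAdelic (σ • v) ψ hψ
  have step2 := (heckeOperator_map_apply_eq _ hgal_inj
    (valuedCongruenceSubgroup (Fin n) (1 : WithZero (Multiplicative ℤ)))
    (π.finiteRep.comp (GLn.ofLocalFiniteAdelic hcpt (σ • v))) (heckeDiag n ϖ j)
    (finite_orbit_valuedCongruenceSubgroup_one n K v _) hxmap).symm
  rw [hKmap, GLn.map_galAdicCompletionMap_heckeDiag F σ v ϖ j, MonoidHom.comp_assoc,
    ← GLn.galOfLocalFiniteAdelic_eq_comp F σ v] at step2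
  rw [step2]
  exact π.heckeOperator_comp_ofLocalFiniteAdelic_mkQ (σ • v) (heckeDiag n _ j) ψ hψ hc

/-- **The central Hecke element of `π^σ` on `W / W'`**: `t_n(ϖ) = ϖ · 1` acts on `[ψ]` through
`σ • ι_v` as `t_n(σ_v ϖ)` placed at `σ v`, i.e. by the scalar `c` of
`[GL_n(𝒪_{σ v}) t_n(σ_v ϖ) GL_n(𝒪_{σ v})] ψ ≡ c ψ (mod W')` (the Hecke operator of a central
element is the element itself, `heckeOperator_apply_of_mem_center`). [folklore] -/
theorem comp_galOfLocalFiniteAdelic_heckeDiag_self_mkQ (σ : K ≃ₐ[F] K) (v : HeightOneSpectrum (𝓞 K))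
    (ϖ : (v.adicCompletion K)ˣ) (ψ : π.W)
    (hψ : (ψ : (AdelicGroupData.gl n K).Adelic → ℂ) ∈
      (rightTranslation (AdelicGroupData.gl n K)).fixedPoints
        (Literature.NumberTheory.Automorphic.sphericalLevelAt K n (σ • v)))
    {c : ℂ} (hc : heckeOperator (rightTranslation (AdelicGroupData.gl n K))
      (Literature.NumberTheory.Automorphic.sphericalLevelAt K n (σ • v))
      (GLn.ofLocal n K (σ • v) (heckeDiag n
        (galAdicCompletionUnitsEquiv (L := K) σ (rfl : σ • v = σ • v) ϖ) n)) ψ - c • (ψ : _ → ℂ) ∈ π.W') :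
    (π.finiteRep.comp (GLn.galOfLocalFiniteAdelic F hcpt σ v)) (heckeDiag n ϖ n) (π.mkQ ψ) =
      c • π.mkQ ψ := by
  have e3 : heckeOperator (rightTranslation (AdelicGroupData.gl n K))
      (Literature.NumberTheory.Automorphic.sphericalLevelAt K n (σ • v))
      (heckeDiagAt n K (σ • v) (galAdicCompletionUnitsEquiv (L := K) σ (rfl : σ • v = σ • v) ϖ) n) ψ =
      rightTranslation (AdelicGroupData.gl n K)
        (heckeDiagAt n K (σ • v) (galAdicCompletionUnitsEquiv (L := K) σ (rfl : σ • v = σ • v) ϖ) n) ψ :=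
    heckeOperator_apply_of_mem_center _ _ (heckeDiagAt_self_mem_center (σ • v) _) hψ
  have hval : ((π.finiteRepW (GLn.galOfLocalFiniteAdelic F hcpt σ v (heckeDiag n ϖ n)) ψ : π.W) :
      (AdelicGroupData.gl n K).Adelic → ℂ) =
      heckeOperator (rightTranslation (AdelicGroupData.gl n K))
        (Literature.NumberTheory.Automorphic.sphericalLevelAt K n (σ • v))
        (GLn.ofLocal n K (σ • v) (heckeDiag n
          (galAdicCompletionUnitsEquiv (L := K) σ (rfl : σ • v = σ • v) ϖ) n)) ψ := by
    rw [← heckeDiagAt_eq_ofLocal, e3, ← GLn.smul_heckeDiagAt F σ v ϖ n, heckeDiagAt_eq_ofLocal]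
    rfl
  have e1 : (π.finiteRep.comp (GLn.galOfLocalFiniteAdelic F hcpt σ v)) (heckeDiag n ϖ n) (π.mkQ ψ) =
      π.mkQ (π.finiteRepW (GLn.galOfLocalFiniteAdelic F hcpt σ v (heckeDiag n ϖ n)) ψ) := rfl
  refine e1.trans ?_
  rw [← map_smul]
  refine (Submodule.Quotient.eq π.kerQuot).2 ?_
  change ((π.finiteRepW (GLn.galOfLocalFiniteAdelic F hcpt σ v (heckeDiag n ϖ n)) ψ - c • ψ : π.W) :
    (AdelicGroupData.gl n K).Adelic → ℂ) ∈ π.W'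
  rw [Submodule.coe_sub, Submodule.coe_smul, hval]
  exact hc

/-- **Averaging over a level.** Let `Λ` be a linear form on `W / W'` invariant under the principal
congruence subgroup `K(𝔫)` (`𝔫 ≠ 0`) and not identically zero. Then `Λ [φ] ≠ 0` for some
`K(𝔫)`-invariant `φ ∈ W`: if `Λ [φ₀] ≠ 0`, average `φ₀` over `K(𝔫) / (K(𝔫) ∩ U₀)` for an open
`U₀ ≤ GL_n(𝔸_K^∞)` fixing `φ₀` (`exists_isOpen_forall_rightTranslation_ofFinite_eq`; finite index,
`finiteIndex_subgroupOf_principalCongruenceLevel`); the average `φ` is `K(𝔫)`-invariant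
(`subgroupQuotientSum_apply_mem_fixedPoints_of_forall`) and `Λ [φ] = [K(𝔫) : K(𝔫) ∩ U₀] Λ [φ₀]`
(Bushnell–Henniart, *The local Langlands conjecture for GL(2)*, §4.2, the idempotent `e_K`).
[folklore] -/
theorem exists_fixed_mkQ_apply_ne_zero {𝔫 : Ideal (𝓞 K)} (h𝔫 : 𝔫 ≠ 0) (Λ : π.Quot →ₗ[ℂ] ℂ)
    (hΛ : ∀ (k : (AdelicGroupData.gl n K).Adelic) (_ : k ∈ principalCongruenceLevel n K 𝔫)
      (hkf : k ∈ (AutomorphyDatum.gl n K hcpt).finiteAdelic) (y : π.Quot),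
      Λ (π.finiteRep ⟨k, hkf⟩ y) = Λ y)
    (hne : ∃ y, Λ y ≠ 0) :
    ∃ φ : π.W, (∀ u ∈ principalCongruenceLevel n K 𝔫,
      rightTranslation (AdelicGroupData.gl n K) u φ = φ) ∧ Λ (π.mkQ φ) ≠ 0 := by
  obtain ⟨y₀, hy₀⟩ := hne
  obtain ⟨φ₀, rfl⟩ := π.kerQuot.mkQ_surjective y₀
  obtain ⟨U₀, hU₀, hfixU⟩ := exists_isOpen_forall_rightTranslation_ofFinite_eq
    (π.stable.le_automorphicForms φ₀.2)
  -- everything typed on `GL (Fin n) (AdeleRing (𝓞 K) K)`, as in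
  -- `finiteIndex_subgroupOf_principalCongruenceLevel`
  let ρ : Representation ℂ (GL (Fin n) (AdeleRing (𝓞 K) K)) ((AdelicGroupData.gl n K).Adelic → ℂ) :=
    rightTranslation (AdelicGroupData.gl n K)
  let L : Subgroup (GL (Fin n) (AdeleRing (𝓞 K) K)) := principalCongruenceLevel n K 𝔫
  let N : Subgroup L := (U₀.comap (GLn.sndHom n K)).subgroupOf L
  haveI : N.FiniteIndex := finiteIndex_subgroupOf_principalCongruenceLevel h𝔫 hU₀
  haveI : Fintype (L ⧸ N) := Fintype.ofFinite _
  have hLf : ∀ g ∈ L, g ∈ (AutomorphyDatum.gl n K hcpt).finiteAdelic :=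
    fun g hg => le_range_ofFinite_of_mem_finiteLevelsGL (glIntegralLevel_mem_finiteLevelsGL n K hcpt)
      (principalCongruenceLevel_le n K 𝔫 hg)
  have hW : ∀ g ∈ L, ∀ v ∈ π.W, ρ g v ∈ π.W :=
    fun g hg v hv => π.stable.finite_stable g (hLf g hg) hv
  -- the average `φ₁` of `φ₀` over `K(𝔫) / N`
  have hφ₁W : (∑ᶠ q : L ⧸ N, ρ ((q.out : L) : GL (Fin n) (AdeleRing (𝓞 K) K)))
      (φ₀ : (AdelicGroupData.gl n K).Adelic → ℂ) ∈ π.W :=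
    subgroupQuotientSum_apply_mem ρ L N hW φ₀.2
  have hφ₁fix : (∑ᶠ q : L ⧸ N, ρ ((q.out : L) : GL (Fin n) (AdeleRing (𝓞 K) K)))
      (φ₀ : (AdelicGroupData.gl n K).Adelic → ℂ) ∈ ρ.fixedPoints L := by
    refine subgroupQuotientSum_apply_mem_fixedPoints_of_forall ρ L N fun u hu => ?_
    have hu2 : GLn.sndHom n K (u : GL (Fin n) (AdeleRing (𝓞 K) K)) ∈ U₀ := hu
    have hu' := GLn.ofFinite_sndHom_of_mem (principalCongruenceLevel_le n K 𝔫 u.2)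
    have := hfixU _ hu2
    rwa [hu'] at this
  refine ⟨⟨_, hφ₁W⟩, fun u hu => (Representation.mem_fixedPoints _ _ _).1 hφ₁fix u hu, ?_⟩
  -- `Λ [φ₁] = [K(𝔫) : N] Λ [φ₀]`
  have hsumW : (⟨_, hφ₁W⟩ : π.W) = ∑ q : L ⧸ N,
      π.finiteRepW ⟨((q.out : L) : GL (Fin n) (AdeleRing (𝓞 K) K)), hLf _ (q.out : L).2⟩ φ₀ := by
    refine Subtype.ext ?_
    change (∑ᶠ q : L ⧸ N, ρ ((q.out : L) : GL (Fin n) (AdeleRing (𝓞 K) K)))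
      (φ₀ : (AdelicGroupData.gl n K).Adelic → ℂ) = _
    rw [AddSubmonoidClass.coe_finsetSum, finsum_eq_sum_of_fintype, LinearMap.sum_apply]
    exact Finset.sum_congr rfl fun q _ => rfl
  have hterm : ∀ q : L ⧸ N, Λ (π.mkQ (π.finiteRepW
      ⟨((q.out : L) : GL (Fin n) (AdeleRing (𝓞 K) K)), hLf _ (q.out : L).2⟩ φ₀)) = Λ (π.mkQ φ₀) :=
    fun q => hΛ _ (q.out : L).2 (hLf _ (q.out : L).2) (π.mkQ φ₀)
  have hval : Λ (π.mkQ ⟨_, hφ₁W⟩) = (Fintype.card (L ⧸ N) : ℂ) * Λ (π.mkQ φ₀) := by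
    rw [hsumW, map_sum, map_sum, Finset.sum_congr rfl fun q _ => hterm q, Finset.sum_const,
      Finset.card_univ, nsmul_eq_mul]
  rw [hval]
  exact mul_ne_zero (Nat.cast_ne_zero.2 Fintype.card_ne_zero) hy₀

end AutomorphicRepData

end LocalFiniteAdelic

namespace AutomorphicRepData

section Defs

open scoped Classical

variable {n : ℕ} {K : Type} [Field K] [NumberField K] {hcpt : isCompact_glFiniteIntegralLevel n K}

/-- **`π` is essentially `σ`-conjugate self-dual with character `χ ∘ det`**:
`π^σ ≅ π^∨ ⊗ (χ ∘ det)`, for an automorphic representation `π = W / W'` of `GL_n(𝔸_K)`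
(Borel–Jacquet datum), `σ ∈ Aut(K/F)` acting on `GL_n(𝔸_K)` entrywise (`π^σ(g) = π(σ g)`,
Arthur–Clozel, Ch. 3 §1) and a Hecke character `χ` of `K` — in the pairing form: there is a
bilinear pairing `B` on `W / W'`, non-degenerate in each variable, such that
(i) `B(π(σ g) x, π(g) y) = χ(det g) B(x, y)` for `g ∈ G(𝔸_f) = {1} × GL_n(𝔸_K^∞)`;
(ii) `B(π(k') x, π(k) y) = χ(det k) B(x, y)` for `k, k' ∈ K_∞` with `k' = σ k` (read in
`GL_n(𝔸_K)`); (iii) `B(X' ψ, φ) + B(ψ, X φ) = dχ(X) B(ψ, φ)` for `X, X' ∈ 𝔤` with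
`exp(tX') = σ exp(tX)` (read in `GL_n(𝔸_K)`) and `d/dt χ(det exp(tX))|₀ = dχ(X)` (Lie derivatives
through right translation). Such a `B` is a non-zero `(𝔤, K_∞) × G(𝔸_f)`-invariant pairing
`π^σ × (π ⊗ (χ∘det)⁻¹) → ℂ`, i.e., `π` being admissible, an isomorphism
`π^σ ≅ (π ⊗ (χ ∘ det)⁻¹)^∨ = π^∨ ⊗ (χ ∘ det)` (Bump (1997), §4.2). For `K` CM and `σ = c` this is
"essentially conjugate self dual" (`IsEssConjSelfDual`); for `σ = 1` "essentially self dual".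
[cite: FakhruddinPilloni2021, §9.1] [cite: BarnetlambEtAl2014, §2.1] -/
def IsGalConjEssSelfDual {F : Type*} [Field F] [Algebra F K]
    (π : AutomorphicRepData (AutomorphyDatum.gl n K hcpt)) (σ : K ≃ₐ[F] K)
    (χ : HeckeCharacter K) : Prop :=
  ∃ B : π.Quot →ₗ[ℂ] π.Quot →ₗ[ℂ] ℂ,
    (∀ x : π.Quot, x ≠ 0 → ∃ y : π.Quot, B x y ≠ 0) ∧
    (∀ y : π.Quot, y ≠ 0 → ∃ x : π.Quot, B x y ≠ 0) ∧
    (∀ (g : (AdelicGroupData.gl n K).Adelic)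
        (hg : g ∈ (AutomorphyDatum.gl n K hcpt).finiteAdelic)
        (hσg : σ • g ∈ (AutomorphyDatum.gl n K hcpt).finiteAdelic) (x y : π.Quot),
        B (π.finiteRep ⟨σ • g, hσg⟩ x) (π.finiteRep ⟨g, hg⟩ y) =
          ((detTwist n χ g : ℂˣ) : ℂ) * B x y) ∧
    (∀ k k' : (AutomorphyDatum.gl n K hcpt).arch.maximalCompact,
        (AutomorphyDatum.gl n K hcpt).ofK k' = σ • (AutomorphyDatum.gl n K hcpt).ofK k →
        ∀ x y : π.Quot, B (π.kRep k' x) (π.kRep k y) =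
          ((detTwist n χ ((AutomorphyDatum.gl n K hcpt).ofK k) : ℂˣ) : ℂ) * B x y) ∧
    (∀ X X' : (AutomorphyDatum.gl n K hcpt).arch.lie,
        (∀ t : ℝ, (AutomorphyDatum.gl n K hcpt).ofArch
            ((AutomorphyDatum.gl n K hcpt).arch.expMem (t • X')) =
          σ • (AutomorphyDatum.gl n K hcpt).ofArch
            ((AutomorphyDatum.gl n K hcpt).arch.expMem (t • X))) →
        ∀ d : ℂ, HasDerivAt (fun t : ℝ => ((detTwist n χ ((AutomorphyDatum.gl n K hcpt).ofArch
            ((AutomorphyDatum.gl n K hcpt).arch.expMem (t • X))) : ℂˣ) : ℂ)) d 0 →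
        ∀ ψ φ : π.W, B (π.mkQ (π.lieDerivW X' ψ)) (π.mkQ φ) +
          B (π.mkQ ψ) (π.mkQ (π.lieDerivW X φ)) = d * B (π.mkQ ψ) (π.mkQ φ))

/-- **`π` is essentially conjugate self-dual with character `χ ∘ det`** (`K` a CM field,
`c` = `NumberField.IsCMField.complexConj K` its complex conjugation, an automorphism of `K` over the
maximal totally real subfield `K⁺`): `π^c ≅ π^∨ ⊗ (χ ∘ det)`, i.e. `IsGalConjEssSelfDual` for
`σ = c`. In Fakhruddin–Pilloni, §9.1 and Barnet-Lamb–Gee–Geraghty–Taylor, §2.1 (RAECSDC) the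
character is `χ = χ₀ ∘ N_{K/K⁺}` for a Hecke character `χ₀` of `K⁺` **subject to the sign
condition** `χ₀,v(-1)` independent of `v ∣ ∞` (Fakhruddin–Pilloni) resp. `χ₀,v(-1) = (-1)^n` for
all `v ∣ ∞` (BLGGT); neither the factorisation through the norm nor the sign condition is part of
this predicate (which takes an arbitrary Hecke character `χ` of `K`), so both must be added
explicitly as hypotheses wherever a result of those sources is vendored. Clozel–Harris–Taylor's
"conjugate self dual" (RACSDC) is `χ = 1`. The central character of `π` is not assumed unitary.
[cite: FakhruddinPilloni2021, §9.1] [cite: BarnetlambEtAl2014, §2.1] -/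
def IsEssConjSelfDual [IsCMField K] (π : AutomorphicRepData (AutomorphyDatum.gl n K hcpt))
    (χ : HeckeCharacter K) : Prop :=
  π.IsGalConjEssSelfDual (NumberField.IsCMField.complexConj K) χ

/-- `IsEssConjSelfDual` is `IsGalConjEssSelfDual` for the complex conjugation (definitional).
[folklore] -/
theorem isEssConjSelfDual_iff [IsCMField K] (π : AutomorphicRepData (AutomorphyDatum.gl n K hcpt))
    (χ : HeckeCharacter K) :
    π.IsEssConjSelfDual χ ↔ π.IsGalConjEssSelfDual (NumberField.IsCMField.complexConj K) χ :=
  Iff.rfl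

end Defs

/-! ### The Satake-level consequence: `t_{π, σ v} = χ_v(ϖ_v) · t_{π, v}⁻¹` -/

section SatakeBridge

open scoped Classical Pointwise

variable {F : Type*} [Field F] {n : ℕ} {K : Type} [Field K] [NumberField K] [Algebra F K]
  {hcpt : isCompact_glFiniteIntegralLevel n K} {π : AutomorphicRepData (AutomorphyDatum.gl n K hcpt)}

/-- `e_{#s}(s) = ∏ s`. [folklore] -/
theorem esymm_card_eq_prod (s : Multiset ℂ) : s.esymm (Multiset.card s) = s.prod := by
  rw [Multiset.esymm, Multiset.powersetCard_self, Multiset.map_singleton, Multiset.sum_singleton]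

/-- **A spherical partner with non-zero pairing.** In the situation of `IsGalConjEssSelfDual`
(finite-adelic clause only), if `χ ∘ det` is trivial on `K^max` and `ψ ∈ W ∖ W'` is invariant under
`K(𝔫')` with `σ v ∤ 𝔫' ≠ 0`, then some `φ₁ ∈ W` spherical at `v` has `B([ψ], [φ₁]) ≠ 0`: the linear
form `B([ψ], ·)` is non-zero (left non-degeneracy) and invariant under `K(σ⁻¹ 𝔫')` (twisted
invariance, `σ K(σ⁻¹ 𝔫') = K(𝔫')` fixing `ψ`), so `exists_fixed_mkQ_apply_ne_zero` applies, and
`K(σ⁻¹ 𝔫') ⊇ GL_n(𝒪_v)` since `v ∤ σ⁻¹ 𝔫'`. [folklore] -/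
theorem exists_spherical_pairing_ne_zero {σ : K ≃ₐ[F] K} {χ : HeckeCharacter K}
    (B : π.Quot →ₗ[ℂ] π.Quot →ₗ[ℂ] ℂ) (hBl : ∀ x : π.Quot, x ≠ 0 → ∃ y : π.Quot, B x y ≠ 0)
    (hBf : ∀ (g : (AdelicGroupData.gl n K).Adelic)
        (hg : g ∈ (AutomorphyDatum.gl n K hcpt).finiteAdelic)
        (hσg : σ • g ∈ (AutomorphyDatum.gl n K hcpt).finiteAdelic) (x y : π.Quot),
        B (π.finiteRep ⟨σ • g, hσg⟩ x) (π.finiteRep ⟨g, hg⟩ y) =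
          ((detTwist n χ g : ℂˣ) : ℂ) * B x y)
    (hχK : ∀ k ∈ glIntegralLevel n K, detTwist n χ k = 1) {v : HeightOneSpectrum (𝓞 K)}
    {𝔫' : Ideal (𝓞 K)} (h𝔫' : 𝔫' ≠ 0) (hv𝔫' : ¬ (σ • v).asIdeal ∣ 𝔫')
    {ψ : (AdelicGroupData.gl n K).Adelic → ℂ} (hψW : ψ ∈ π.W) (hψW' : ψ ∉ π.W')
    (hψfix : ∀ u ∈ principalCongruenceLevel n K 𝔫', rightTranslation (AdelicGroupData.gl n K) u ψ = ψ) :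
    ∃ φ₁ : π.W, (φ₁ : (AdelicGroupData.gl n K).Adelic → ℂ) ∈
      (rightTranslation (AdelicGroupData.gl n K)).fixedPoints (Literature.NumberTheory.Automorphic.sphericalLevelAt K n v) ∧
        B (π.mkQ ⟨ψ, hψW⟩) (π.mkQ φ₁) ≠ 0 := by
  have hx0 : π.mkQ ⟨ψ, hψW⟩ ≠ 0 := fun h0 => hψW' ((Submodule.Quotient.mk_eq_zero π.kerQuot).1 h0)
  have hσ𝔪 : σ • (σ⁻¹ • 𝔫') = 𝔫' := smul_inv_smul σ 𝔫'
  have h𝔪 : σ⁻¹ • 𝔫' ≠ 0 := fun h0 => h𝔫' (by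
    rw [← hσ𝔪, h0, Ideal.pointwise_smul_def, Submodule.zero_eq_bot, Ideal.map_bot])
  have hv𝔪 : ¬ v.asIdeal ∣ σ⁻¹ • 𝔫' := fun hd => hv𝔫' (by
    rw [Ideal.dvd_iff_le] at hd ⊢
    have := Ideal.map_mono (f := MulSemiringAction.toRingHom (K ≃ₐ[F] K) (𝓞 K) σ) hd
    rwa [← Ideal.pointwise_smul_def, ← Ideal.pointwise_smul_def, hσ𝔪,
      ← HeightOneSpectrum.smul_asIdeal] at this)
  have hΛ : ∀ (k : (AdelicGroupData.gl n K).Adelic) (_ : k ∈ principalCongruenceLevel n K (σ⁻¹ • 𝔫'))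
      (hkf : k ∈ (AutomorphyDatum.gl n K hcpt).finiteAdelic) (y : π.Quot),
      B (π.mkQ ⟨ψ, hψW⟩) (π.finiteRep ⟨k, hkf⟩ y) = B (π.mkQ ⟨ψ, hψW⟩) y := by
    intro k hk hkf y
    have hσk : σ • k ∈ principalCongruenceLevel n K 𝔫' := by
      rw [← hσ𝔪]
      exact (GLn.smul_mem_principalCongruenceLevel_iff F σ (σ⁻¹ • 𝔫') k).2 hk
    have hσkf := GLn.smul_mem_range_ofFinite F σ hkf
    have hxk : π.finiteRep ⟨σ • k, hσkf⟩ (π.mkQ ⟨ψ, hψW⟩) = π.mkQ ⟨ψ, hψW⟩ := by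
      have e : π.finiteRepW ⟨σ • k, hσkf⟩ ⟨ψ, hψW⟩ = ⟨ψ, hψW⟩ := Subtype.ext (hψfix _ hσk)
      exact congrArg π.mkQ e
    have h1 := hBf k hkf hσkf (π.mkQ ⟨ψ, hψW⟩) y
    have h2 : ((detTwist n χ k : ℂˣ) : ℂ) = 1 := by
      rw [hχK k (principalCongruenceLevel_le n K _ hk), Units.val_one]
    rw [hxk, h2, one_mul] at h1
    exact h1
  obtain ⟨φ₁, hφ₁fix, hBne⟩ := π.exists_fixed_mkQ_apply_ne_zero h𝔪 (B (π.mkQ ⟨ψ, hψW⟩)) hΛ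
    (hBl _ hx0)
  exact ⟨φ₁, (Representation.mem_fixedPoints _ _ _).2 fun k hk =>
    hφ₁fix k (isMaximalAt_principalCongruenceLevel n K v h𝔪 hv𝔪 hk), hBne⟩

/-- An eigenvalue of an invertible operator on a non-zero vector is non-zero. [folklore] -/
theorem eigenvalue_ne_zero_of_ne_zero {G V : Type*} [Group G] [AddCommGroup V] [Module ℂ V]
    (ρ : Representation ℂ G V) (g : G) {x : V} (hx : x ≠ 0) {e : ℂ} (he : ρ g x = e • x) : e ≠ 0 := by
  rintro rfl
  rw [zero_smul] at he
  apply hx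
  calc x = ρ g⁻¹ (ρ g x) := by
        rw [← Module.End.mul_apply, ← map_mul, inv_mul_cancel, map_one, Module.End.one_apply]
    _ = 0 := by rw [he, map_zero]

/-- **Vieta step.** If `#α = #β = n`, `e_n(β) ≠ 0`, `z ≠ 0` and
`e_i(α) e_n(β) = z^i e_{n-i}(β)` for all `i ≤ n`, then `β = {z a⁻¹ : a ∈ α}` (equivalently
`α = {z b⁻¹ : b ∈ β}`: both sides have the same elementary symmetric functions,
`esymm_map_inv_mul_prod`, `multiset_eq_of_esymm_eq`). [folklore] -/
theorem multiset_eq_map_inv_mul_of_esymm_mul_eq {α β : Multiset ℂ} {n : ℕ} (hα : Multiset.card α = n)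
    (hβ : Multiset.card β = n) (hen : β.esymm n ≠ 0) {z : ℂ} (hz : z ≠ 0)
    (key : ∀ i ≤ n, α.esymm i * β.esymm n = z ^ i * β.esymm (n - i)) :
    β = α.map (fun a ↦ a⁻¹ * z) := by
  have hprod : β.prod = β.esymm n := by rw [← hβ, esymm_card_eq_prod]
  have hβ0 : ∀ b ∈ β, b ≠ 0 := by
    intro b hb hb0
    apply hen
    rw [← hprod]
    exact Multiset.prod_eq_zero (hb0 ▸ hb)
  have hαγ : α = (β.map (·⁻¹)).map (z * ·) := by
    refine multiset_eq_of_esymm_eq (by rw [Multiset.card_map, Multiset.card_map, hα, hβ])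
      fun j hj => ?_
    rw [hα] at hj
    rw [esymm_map_const_mul]
    apply mul_right_cancel₀ hen
    have hj' : j + (n - j) = Multiset.card β := by rw [hβ]; omega
    rw [key j hj, mul_assoc, ← hprod, esymm_map_inv_mul_prod β hβ0 hj']
  rw [hαγ, Multiset.map_map, Multiset.map_map]
  conv_lhs => rw [← Multiset.map_id β]
  refine Multiset.map_congr rfl fun b _ => ?_
  simp only [Function.comp_apply, id_eq, mul_inv_rev, inv_inv]
  rw [mul_assoc, inv_mul_cancel₀ hz, mul_one]

/-- **Satake parameters of an essentially `σ`-conjugate self-dual representation.** Let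
`π = W / W'` be an automorphic representation of `GL_n(𝔸_K)` (Borel–Jacquet datum) with
`π^σ ≅ π^∨ ⊗ (χ ∘ det)` in the sense of `IsGalConjEssSelfDual`, and suppose `χ ∘ det` is trivial on
the integral level `K^max = {1} × GL_n(𝒪̂_K)` (e.g. `χ = ‖·‖^s`). If `π` has Satake parameter `α`
at `v` and `β` at `σ v`, then `β = {χ_v(ϖ) a⁻¹ : a ∈ α}` for the uniformizer `ϖ` at `v` witnessing
`α`, i.e. `t_{π, σ v} = χ_v(ϖ_v) t_{π,v}⁻¹` (the unramified shadow of `π^σ_v ≅ π_v^∨ ⊗ χ_v(det)`: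
`t_{π^σ, v} = t_{π, σ v}`, `t_{π^∨, v} = t_{π, v}⁻¹`, `t_{π ⊗ χ, v} = χ_v(ϖ_v) t_{π, v}`;
Arthur–Clozel (1989), Ch. 3, p. 172 and Prop. 4.4; Clozel (1990), §1.1; Bump (1997), Prop. 4.6.2).
Proof: the pairing `B` of the definition, restricted along `ι_v : GL_n(K_v) → G(𝔸_f)` to the
classes of a spherical vector `[ψ]` of `π` at `σ v` and of an averaged spherical vector `[φ₁]` at
`v` with `B([ψ], [φ₁]) ≠ 0` (`exists_fixed_mkQ_apply_ne_zero`), satisfies the hypotheses of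
`heckeEigenvalue_mul_eq_of_bilin_invariant` with the local Hecke eigenvalues
`q_v^{i(n-i)/2} e_i` (the unramified Hecke algebra acts by scalars modulo `W'`,
`exists_heckeOperator_sphericalLevelAt_sub_smul_mem`), the relation `t_i⁻¹ = t_n⁻¹ (w t_{n-i} w⁻¹)`
(`exists_perm_conj_heckeDiag`) and `#(K t_i K / K) = #(K t_{n-i} K / K)`
(`ncard_orbit_eq_of_inv_eq`); this gives `e_i(α) e_n(β) = χ_v(ϖ)^i e_{n-i}(β)` for `i ≤ n`,
whence the claim by Vieta (`esymm_map_inv_mul_prod`, `multiset_eq_of_esymm_eq`).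
[cite: ArthurClozelAMS120, Ch. 3, proof of Thm. 3.1 (p. 172)] -/
theorem IsGalConjEssSelfDual.exists_satakeParam_smul_eq {σ : K ≃ₐ[F] K} {χ : HeckeCharacter K}
    (h : π.IsGalConjEssSelfDual σ χ) (hχK : ∀ k ∈ glIntegralLevel n K, detTwist n χ k = 1)
    {v : HeightOneSpectrum (𝓞 K)} {α β : Multiset ℂ} (hα : π.HasSatakeParamAt v α)
    (hβ : π.HasSatakeParamAt (σ • v) β) :
    ∃ ϖ : (v.adicCompletion K)ˣ, Valued.v (ϖ : v.adicCompletion K) = WithZero.exp (-1 : ℤ) ∧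
      β = α.map (fun a ↦ a⁻¹ *
        ((χ (Literature.NumberTheory.GaloisRepresentations.localUnits v ϖ) : ℂˣ) : ℂ)) := by
  obtain ⟨B, hBl, -, hBf, -, -⟩ := h
  obtain ⟨𝔫, ϖ, h𝔫, hv𝔫, hϖ, hcardα, φ, hφW, hφW', hφfix, hTφ⟩ := hα
  obtain ⟨𝔫', ϖ', h𝔫', hv𝔫', hϖ', hcardβ, ψ, hψW, hψW', hψfix, hTψ⟩ := hβ
  refine ⟨ϖ, hϖ, ?_⟩
  -- the local groups, the transported uniformizer, the restricted actions and the character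
  set K₀ : Subgroup (GL (Fin n) (v.adicCompletion K)) :=
    valuedCongruenceSubgroup (Fin n) (1 : WithZero (Multiplicative ℤ)) with hK₀
  set ϖσ : ((σ • v).adicCompletion K)ˣ :=
    galAdicCompletionUnitsEquiv (L := K) σ (rfl : σ • v = σ • v) ϖ with hϖσ
  have hϖσv : Valued.v (ϖσ : (σ • v).adicCompletion K) = WithZero.exp (-1 : ℤ) := by
    rw [hϖσ, valued_galAdicCompletionUnitsEquiv, hϖ]
  set ρ₂ : Representation ℂ (GL (Fin n) (v.adicCompletion K)) π.Quot :=
    π.finiteRep.comp (GLn.ofLocalFiniteAdelic hcpt v) with hρ₂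
  set ρ₁ : Representation ℂ (GL (Fin n) (v.adicCompletion K)) π.Quot :=
    π.finiteRep.comp (GLn.galOfLocalFiniteAdelic F hcpt σ v) with hρ₁
  set c : GL (Fin n) (v.adicCompletion K) →* ℂˣ := (detTwist n χ).comp (GLn.ofLocal n K v) with hc
  set z₀ : ℂ := ((χ (Literature.NumberTheory.GaloisRepresentations.localUnits v ϖ) : ℂˣ) : ℂ) with hz₀
  set Q : ℂ := (((Real.sqrt (v.residueCard : ℝ)) : ℝ) : ℂ) with hQ
  have hQσ : (((Real.sqrt ((σ • v).residueCard : ℝ)) : ℝ) : ℂ) = Q := by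
    rw [hQ, HeightOneSpectrum.residueCard_smul F σ v]
  have hQ0 : Q ≠ 0 := sqrt_residueCard_ne_zero v
  -- (0) twisted invariance and triviality of `c` on `K₀`
  have hB : ∀ (g : GL (Fin n) (v.adicCompletion K)) (x y : π.Quot),
      B (ρ₁ g x) (ρ₂ g y) = ((c g : ℂˣ) : ℂ) * B x y := fun g x y =>
    hBf (GLn.ofLocal n K v g) (GLn.ofLocal_mem_range_ofFinite v g)
      (GLn.smul_mem_range_ofFinite F σ (GLn.ofLocal_mem_range_ofFinite v g)) x y
  have hcK : ∀ k ∈ K₀, c k = 1 := fun k hk =>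
    hχK _ (isMaximalAt_glIntegralLevel n K v ⟨k, hk, rfl⟩)
  -- (1) spherical invariance of `φ` at `v` and of `ψ` at `σ v`
  have hφfixP : φ ∈ (rightTranslation (AdelicGroupData.gl n K)).fixedPoints
      (principalCongruenceLevel n K 𝔫) := (Representation.mem_fixedPoints _ _ _).2 hφfix
  have hψfixP : ψ ∈ (rightTranslation (AdelicGroupData.gl n K)).fixedPoints
      (principalCongruenceLevel n K 𝔫') := (Representation.mem_fixedPoints _ _ _).2 hψfix
  have hφsph : φ ∈ (rightTranslation (AdelicGroupData.gl n K)).fixedPoints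
      (Literature.NumberTheory.Automorphic.sphericalLevelAt K n v) :=
    (Representation.mem_fixedPoints _ _ _).2 fun k hk =>
      hφfix k (isMaximalAt_principalCongruenceLevel n K v h𝔫 hv𝔫 hk)
  have hψsph : ψ ∈ (rightTranslation (AdelicGroupData.gl n K)).fixedPoints
      (Literature.NumberTheory.Automorphic.sphericalLevelAt K n (σ • v)) :=
    (Representation.mem_fixedPoints _ _ _).2 fun k hk =>
      hψfix k (isMaximalAt_principalCongruenceLevel n K (σ • v) h𝔫' hv𝔫' hk)
  -- (2) the eigenform equations at the local spherical levels (and the uniformizer `σ_v ϖ` at `σ v`)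
  have hTφ' : ∀ i ≤ n, heckeOperator (rightTranslation (AdelicGroupData.gl n K))
      (Literature.NumberTheory.Automorphic.sphericalLevelAt K n v) (GLn.ofLocal n K v (heckeDiag n ϖ i)) φ -
        (Q ^ (i * (n - i)) * α.esymm i) • φ ∈ π.W' := by
    intro i hi
    have e : heckeOperator (rightTranslation (AdelicGroupData.gl n K))
        (Literature.NumberTheory.Automorphic.sphericalLevelAt K n v) (GLn.ofLocal n K v (heckeDiag n ϖ i)) φ =
        heckeOperator (rightTranslation (AdelicGroupData.gl n K)) (principalCongruenceLevel n K 𝔫)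
          (GLn.ofLocal n K v (heckeDiag n ϖ i)) φ :=
      heckeOperator_sphericalLevelAt_eq_principalCongruenceLevel _ h𝔫 hv𝔫 _ hφfixP
    rw [e, ← heckeDiagAt_eq_ofLocal]
    exact hTφ i hi
  have hTψ' : ∀ j ≤ n, heckeOperator (rightTranslation (AdelicGroupData.gl n K))
      (Literature.NumberTheory.Automorphic.sphericalLevelAt K n (σ • v))
        (GLn.ofLocal n K (σ • v) (heckeDiag n ϖσ j)) ψ - (Q ^ (j * (n - j)) * β.esymm j) • ψ ∈ π.W' := by
    intro j hj
    have e : heckeOperator (rightTranslation (AdelicGroupData.gl n K))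
        (Literature.NumberTheory.Automorphic.sphericalLevelAt K n (σ • v))
          (GLn.ofLocal n K (σ • v) (heckeDiag n ϖσ j)) ψ =
        heckeOperator (rightTranslation (AdelicGroupData.gl n K)) (principalCongruenceLevel n K 𝔫')
          (GLn.ofLocal n K (σ • v) (heckeDiag n ϖσ j)) ψ :=
      heckeOperator_sphericalLevelAt_eq_principalCongruenceLevel _ h𝔫' hv𝔫' _ hψfixP
    have e2 : heckeOperator (rightTranslation (AdelicGroupData.gl n K)) (principalCongruenceLevel n K 𝔫')
        (heckeDiagAt n K (σ • v) ϖ' j) = heckeOperator (rightTranslation (AdelicGroupData.gl n K))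
          (principalCongruenceLevel n K 𝔫') (heckeDiagAt n K (σ • v) ϖσ j) :=
      heckeOperator_heckeDiagAt_eq_of_valuation_eq (rightTranslation (AdelicGroupData.gl n K))
        (isMaximalAt_principalCongruenceLevel n K (σ • v) h𝔫' hv𝔫') (by rw [hϖ', hϖσv]) j
    rw [e, ← heckeDiagAt_eq_ofLocal, ← e2, ← hQσ]
    exact hTψ j hj
  -- (3) the spherical Hecke algebra at `v` acts by the scalars of `φ` modulo `W'`
  have hflath : ∀ i ≤ n, ∀ φ₁ ∈ π.W, φ₁ ∈ (rightTranslation (AdelicGroupData.gl n K)).fixedPoints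
      (Literature.NumberTheory.Automorphic.sphericalLevelAt K n v) →
      heckeOperator (rightTranslation (AdelicGroupData.gl n K))
        (Literature.NumberTheory.Automorphic.sphericalLevelAt K n v) (GLn.ofLocal n K v (heckeDiag n ϖ i)) φ₁ -
          (Q ^ (i * (n - i)) * α.esymm i) • φ₁ ∈ π.W' := by
    intro i hi φ₁ hφ₁W hφ₁sph
    obtain ⟨c₀, hc₀⟩ := π.exists_heckeOperator_sphericalLevelAt_sub_smul_mem v (heckeDiag n ϖ i)
    have h1 := hc₀ φ hφW hφsph
    have h2 := hTφ' i hi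
    have hc₀eq : c₀ = Q ^ (i * (n - i)) * α.esymm i := by
      by_contra hne
      apply hφW'
      have h3 : (Q ^ (i * (n - i)) * α.esymm i - c₀) • φ ∈ π.W' := by
        have := π.W'.sub_mem h1 h2
        rwa [sub_sub_sub_cancel_left, ← sub_smul] at this
      have h4 := π.W'.smul_mem (Q ^ (i * (n - i)) * α.esymm i - c₀)⁻¹ h3
      rwa [smul_smul, inv_mul_cancel₀ (sub_ne_zero.2 (Ne.symm hne)), one_smul] at h4
    rw [← hc₀eq]
    exact hc₀ φ₁ hφ₁W hφ₁sph
  -- (4) the class `x = [ψ]`: non-zero, fixed by `ρ₁(K₀)`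
  have hx0 : π.mkQ ⟨ψ, hψW⟩ ≠ 0 := fun h0 => hψW' ((Submodule.Quotient.mk_eq_zero π.kerQuot).1 h0)
  have hx : π.mkQ ⟨ψ, hψW⟩ ∈ ρ₁.fixedPoints K₀ :=
    π.mkQ_mem_fixedPoints_comp_galOfLocalFiniteAdelic F σ v ⟨ψ, hψW⟩ hψsph
  -- (5) a spherical `φ₁ ∈ W` at `v` with `B([ψ], [φ₁]) ≠ 0`
  obtain ⟨φ₁, hφ₁sph, hBne⟩ := π.exists_spherical_pairing_ne_zero B hBl hBf hχK h𝔫' hv𝔫' hψW hψW' hψfix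
  have hy : π.mkQ φ₁ ∈ ρ₂.fixedPoints K₀ := π.mkQ_mem_fixedPoints_comp_ofLocalFiniteAdelic v φ₁ hφ₁sph
  -- (6) the Hecke eigenvalue equations on `W / W'`
  have ha : ∀ i ≤ n, heckeOperator ρ₂ K₀ (heckeDiag n ϖ i) (π.mkQ φ₁) =
      (Q ^ (i * (n - i)) * α.esymm i) • π.mkQ φ₁ := fun i hi =>
    π.heckeOperator_comp_ofLocalFiniteAdelic_mkQ v (heckeDiag n ϖ i) φ₁ hφ₁sph
      (hflath i hi φ₁ φ₁.2 hφ₁sph)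
  have hb : ∀ j ≤ n, heckeOperator ρ₁ K₀ (heckeDiag n ϖ j) (π.mkQ ⟨ψ, hψW⟩) =
      (Q ^ (j * (n - j)) * β.esymm j) • π.mkQ ⟨ψ, hψW⟩ := fun j hj =>
    π.heckeOperator_comp_galOfLocalFiniteAdelic_mkQ F σ v ϖ j ⟨ψ, hψW⟩ hψsph (hTψ' j hj)
  have he : ρ₁ (heckeDiag n ϖ n) (π.mkQ ⟨ψ, hψW⟩) = (Q ^ (n * (n - n)) * β.esymm n) • π.mkQ ⟨ψ, hψW⟩ :=
    π.comp_galOfLocalFiniteAdelic_heckeDiag_self_mkQ F σ v ϖ ⟨ψ, hψW⟩ hψsph (hTψ' n le_rfl)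
  -- (7) the adjoint relations `e_i(α) e_n(β) = z₀^i e_{n-i}(β)`
  have hcval : ∀ i ≤ n, ((c (heckeDiag n ϖ i) : ℂˣ) : ℂ) = z₀ ^ i := fun i hi => by
    change ((detTwist n χ (GLn.ofLocal n K v (heckeDiag n ϖ i)) : ℂˣ) : ℂ) = _
    rw [← heckeDiagAt_eq_ofLocal, detTwist_apply, det_heckeDiagAt v ϖ hi, map_pow,
      Units.val_pow_eq_pow_val]
  have key : ∀ i ≤ n, α.esymm i * β.esymm n = z₀ ^ i * β.esymm (n - i) := by
    intro i hi
    obtain ⟨w, hw01, hww, hwD⟩ := exists_perm_conj_heckeDiag (v.adicCompletion K) n ϖ hi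
    have hwinv : w⁻¹ = w := inv_eq_of_mul_eq_one_right hww
    have hwK : w ∈ K₀ := mem_valuedCongruenceSubgroup_one_of_entries hw01 hwinv
    have hxyz : (heckeDiag n ϖ i)⁻¹ = (heckeDiag n ϖ n)⁻¹ * (w * heckeDiag n ϖ (n - i) * w⁻¹) := by
      refine inv_eq_of_mul_eq_one_left ?_
      rw [mul_assoc, hwD, inv_mul_cancel]
    have hfinI := finite_orbit_valuedCongruenceSubgroup_one n K v (heckeDiag n ϖ i)
    have hfinJ := finite_orbit_valuedCongruenceSubgroup_one n K v (heckeDiag n ϖ (n - i))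
    have hN : hfinI.toFinset.card = hfinJ.toFinset.card := by
      rw [← Set.ncard_eq_toFinset_card _ hfinI, ← Set.ncard_eq_toFinset_card _ hfinJ]
      exact ncard_orbit_eq_of_inv_eq (heckeDiag_self_mem_center ϖ) hwK hxyz
    have h := heckeEigenvalue_mul_eq_of_bilin_invariant ρ₁ ρ₂ c B hB K₀ hcK hx hy hwK
      (heckeDiag_self_mem_center ϖ) hxyz hfinI hfinJ hN (ha i hi) (hb (n - i) (Nat.sub_le n i))
      he hBne
    rw [hcval i hi, Nat.sub_sub_self hi, Nat.sub_self, mul_zero, pow_zero, one_mul,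
      Nat.mul_comm (n - i) i] at h
    -- `h : Q^{i(n-i)} e_i(α) e_n(β) = z₀^i (Q^{i(n-i)} e_{n-i}(β))`
    have hQp : Q ^ (i * (n - i)) ≠ 0 := pow_ne_zero _ hQ0
    apply mul_left_cancel₀ hQp
    calc Q ^ (i * (n - i)) * (α.esymm i * β.esymm n)
        = Q ^ (i * (n - i)) * α.esymm i * β.esymm n := by ring
      _ = z₀ ^ i * (Q ^ (i * (n - i)) * β.esymm (n - i)) := h
      _ = Q ^ (i * (n - i)) * (z₀ ^ i * β.esymm (n - i)) := by ring
  -- (8) `e_n(β) ≠ 0`, `z₀ ≠ 0`, and Vieta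
  have hen : β.esymm n ≠ 0 := by
    have h := eigenvalue_ne_zero_of_ne_zero ρ₁ (heckeDiag n ϖ n) hx0 he
    rw [Nat.sub_self, mul_zero, pow_zero, one_mul] at h
    exact h
  exact multiset_eq_map_inv_mul_of_esymm_mul_eq hcardα hcardβ hen (Units.ne_zero _) key

/-- **`t_{π, σ v} = χ_v(ϖ_v) t_{π,v}⁻¹`** for an essentially `σ`-conjugate self-dual `π` with
`χ ∘ det` trivial on `K^max` and `χ` unramified at `v` (so that `χ_v(ϖ)` is `χ.valueAtUniformizer v`
for every uniformizer `ϖ`, `HeckeCharacter.localComponent_eq_valueAtUniformizer`).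
[cite: ArthurClozelAMS120, Ch. 3, proof of Thm. 3.1 (p. 172)] -/
theorem IsGalConjEssSelfDual.satakeParam_smul_eq {σ : K ≃ₐ[F] K} {χ : HeckeCharacter K}
    (h : π.IsGalConjEssSelfDual σ χ) (hχK : ∀ k ∈ glIntegralLevel n K, detTwist n χ k = 1)
    {v : HeightOneSpectrum (𝓞 K)} (hχv : χ.IsUnramifiedAt v) {α β : Multiset ℂ}
    (hα : π.HasSatakeParamAt v α) (hβ : π.HasSatakeParamAt (σ • v) β) :
    β = α.map (fun a ↦ a⁻¹ * χ.valueAtUniformizer v) := by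
  obtain ⟨ϖ, hϖ, e⟩ := h.exists_satakeParam_smul_eq hχK hα hβ
  rw [e]
  refine Multiset.map_congr rfl fun a _ => ?_
  rw [← HeckeCharacter.localComponent_eq_valueAtUniformizer hχv hϖ, HeckeCharacter.localComponent_apply]

/-- **Essentially conjugate self-dual up to `|det|^m`, Satake form.** Let `K` be a CM field with
complex conjugation `c`, `χ = ‖·‖_𝔸^m` (`m ∈ ℤ`) and `π` an automorphic representation of
`GL_n(𝔸_K)` with `π^c ≅ π^∨ ⊗ |det|_𝔸^m` (`IsEssConjSelfDual π χ`). If `π` has Satake parameter `α`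
at `v` and `β` at the conjugate place `c v` (written, as in route `Langlands/DegenerateLimits`, as
the transport of `v` along `ringOfIntegersComplexConj K`), then
`β = {a⁻¹ q_v^{-m} : a ∈ α}` — for **every** finite place `v` (`|det|^m` is unramified everywhere
and trivial on `K^max`, `apply_det_eq_one_of_mem_finiteLevelsGL`; `|ϖ_v|_𝔸^m = q_v^{-m}`,
`detTwist_heckeDiagAt_of_cpow`). [cite: FakhruddinPilloni2021, §9.1]
[cite: ArthurClozelAMS120, Ch. 3, proof of Thm. 3.1 (p. 172)] -/
theorem IsEssConjSelfDual.satakeParam_complexConj_eq_of_ideleNorm_cpow [IsCMField K]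
    {χ : HeckeCharacter K} {m : ℤ}
    (hχ : ∀ x : Literature.NumberTheory.GaloisRepresentations.ideleGroup K,
      ((χ x : ℂˣ) : ℂ) = (Literature.NumberTheory.GaloisRepresentations.ideleNorm x : ℂ) ^ (m : ℂ))
    (h : π.IsEssConjSelfDual χ) {v : HeightOneSpectrum (𝓞 K)} {α β : Multiset ℂ}
    (hα : π.HasSatakeParamAt v α)
    (hβ : π.HasSatakeParamAt (HeightOneSpectrum.equivOfRingEquiv
      (NumberField.IsCMField.ringOfIntegersComplexConj K).toRingEquiv v) β) :
    β = α.map (fun a ↦ a⁻¹ * (v.residueCard : ℂ) ^ (-m)) := by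
  rw [← IsCMField.complexConj_smul_eq_equivOfRingEquiv] at hβ
  have hχK : ∀ k ∈ glIntegralLevel n K, detTwist n χ k = 1 := fun k hk =>
    apply_det_eq_one_of_mem_finiteLevelsGL hχ (glIntegralLevel_mem_finiteLevelsGL n K hcpt) hk
  obtain ⟨ϖ, hϖ, e⟩ := IsGalConjEssSelfDual.exists_satakeParam_smul_eq h hχK hα hβ
  rcases Nat.eq_zero_or_pos n with hn | hn
  · -- `n = 0`: both parameters are empty
    subst hn
    have hα0 : α = 0 := Multiset.card_eq_zero.1 hα.card_eq
    have hβ0 : β = 0 := Multiset.card_eq_zero.1 hβ.card_eq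
    rw [hα0, hβ0, Multiset.map_zero]
  rw [e]
  refine Multiset.map_congr rfl fun a _ => ?_
  congr 1
  have h1 : Literature.NumberTheory.GaloisRepresentations.localUnits v ϖ =
      Matrix.GeneralLinearGroup.det (heckeDiagAt n K v ϖ 1) := by
    rw [det_heckeDiagAt v ϖ hn, pow_one]
  rw [h1, ← detTwist_apply, detTwist_heckeDiagAt_of_cpow hχ hϖ hn, pow_one,
    show (-(m : ℂ)) = ((-m : ℤ) : ℂ) by push_cast; ring, Complex.cpow_intCast]

/-- **Hypothesis (ii) of route `Langlands/DegenerateLimits`, verbatim.** For `K` CM,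
`χ = ‖·‖_𝔸^m` and `π` with `π^c ≅ π^∨ ⊗ |det|^m` (`IsEssConjSelfDual π χ`): for cofinitely many
(indeed all) finite places `v`, any Satake parameters `α` at `v` and `β` at the conjugate place
satisfy `β = α.map (a ↦ a⁻¹ q_v^{-m})`. [cite: FakhruddinPilloni2021, §9.1] -/
theorem IsEssConjSelfDual.eventually_satakeParam_complexConj_eq [IsCMField K]
    {χ : HeckeCharacter K} {m : ℤ}
    (hχ : ∀ x : Literature.NumberTheory.GaloisRepresentations.ideleGroup K,
      ((χ x : ℂˣ) : ℂ) = (Literature.NumberTheory.GaloisRepresentations.ideleNorm x : ℂ) ^ (m : ℂ))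
    (h : π.IsEssConjSelfDual χ) :
    ∀ᶠ v : HeightOneSpectrum (𝓞 K) in Filter.cofinite, ∀ α β : Multiset ℂ,
      π.HasSatakeParamAt v α →
        π.HasSatakeParamAt (HeightOneSpectrum.equivOfRingEquiv
          (NumberField.IsCMField.ringOfIntegersComplexConj K).toRingEquiv v) β →
          β = α.map (fun a ↦ a⁻¹ * (v.residueCard : ℂ) ^ (-m)) :=
  Filter.Eventually.of_forall fun _ _ _ hα hβ =>
    h.satakeParam_complexConj_eq_of_ideleNorm_cpow hχ hα hβ

end SatakeBridge

end AutomorphicRepData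

end Literature.NumberTheory.Automorphic
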